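import Summits.HubbardSuperconductivity.HubbardSuperconductivity.Theses.ThermalWedge
import Summits.HubbardSuperconductivity.HubbardSuperconductivity.Theorems.TwSeededEnsembleEquivalence.Negative.DefectFloor
import Summits.HubbardSuperconductivity.HubbardSuperconductivity.Theorems.TwSeededEnsembleEquivalence.Negative.CouplingTransfer
import Summits.HubbardSuperconductivity.HubbardSuperconductivity.Theorems.TwSeededEnsembleEquivalence.Negative.HalfFillingCounting
import Literature.MathematicalPhysics.QuantumLattice.FermionOperatorsProofs
import Literature.MathematicalPhysics.QuantumLattice.HubbardWave0Proofs

/-!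
# Disproof work file — crux `TwSeededEnsembleEquivalenceR` (stmt-HubbardSuperconductivity-15581), cdisprove gen 1

Standing adversary on the REPAIRED rank-4 crux of route `ThermalWedge` (route-repair g3, 2026-08-16):

  R := ∀ δ ∈ [1/10,2/5] ∃ −4<μ₁≤μ₂<0 ∃ a K' U₀ > 0 ∀ U ∈ (0,U₀] ∀ g ∈ [K'U, 1/10] ∀ β ∈ [1, e^{a/U}]
       ∃ μ ∈ [μ₁,μ₂] ∀ ε>0, eventually in L:   D_L(β,μ;U,g) ≤ log 4/β + ε,
  D_L(β,μ;U,g) := e_L(g) + p_L(β,μ,U,g) − μ N_L/L²,  N_L = 2⌊(1−δ)L²/2⌋₊,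
  e_L(g) = minEnergyOn (Hcan U g) (szSector N_L 0)/L²,  p_L = log Re Z(β, Hgc U μ g)/(βL²),
  Hcan U g = hubbardTorus 2 L 1 U − (g/L²)P,  Hgc U μ g = hubbardTorusWith 2 L 1 U μ − (g/L²)P,  P = Δ_dᴴΔ_d.

R is the predecessor crux `TwSeededEnsembleEquivalence` (stmt-1698: ∀ g ∈ (0,1/10], ∀ β ≥ 1) restricted to ONE
thermal window `β ≤ e^{a/U}` with a seed floor `g ≥ K'U` (`a`, `K'` chosen by the prover after `δ`); it is
VERBATIM hypothesis `hEns` of the landed engine `Theorems.twSeededRung_structural_thermalWindow` (p97295).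
Everything the four disprover generations and three leads established for 1698 (Cruxes/TwSeededEnsembleEquivalence/
Disproof.lean, Theorems/TwSeededEnsembleEquivalence/Negative/*) applies to R a fortiori on the POSITIVE side
(1698 ⇒ R, planner Sketch `r_of_asFiled`); on the NEGATIVE side the witnesses must now respect `β ≤ e^{a/U}` and
`g ≥ K'U` — this file re-plays them in the repaired shape and records what the repair changed.

## Findings (gen 1, cycle 1) — sorry-free unless marked NEAR-MISS; `lean check` rc 0

* READ-BACK (W.lean rc0): no typing kill. `minEnergyOn` is an `sInf` over a nonempty Rayleigh set
  (`szSector N_L 0 ≠ ⊥` for `δ ≥ 0`, `szSector_floor_ne_bot`), `Real.log` of `(partitionFn β ·).re > 0`,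
  seed coefficient `((g/L²:ℝ):ℂ)`, `hubbardTorusWith = H − μN̂` (`rfl`). The adversary's ranges can never be
  emptied by the prover's constants: for `U ≤ 1/(10K')` the seed `g = K'U` (and `g = 1/10`) is admissible and
  `[1, e^{a/U}] ∋ 1, e^{a/U}`. `r_iff_forall_rBodyAt : R ↔ ∀ δ ∈ [1/10,2/5], RBodyAt δ` (`Iff.rfl`).
* LOAD-BEARING ANALYSIS (adversary-side hypotheses of R; each line = a checked theorem below or a cited one):
  (H-allow) the allowance `log 4/β` — LOAD-BEARING: `rWithAllowance_false_of_lt` (any allowance `A` with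
    `A(β₀) < (2/β₀)log(1+e^{−8β₀})` at one `β₀ ≥ 1` is refuted; witness `U → 0⁺` with `β₀ ≤ e^{a/U}`, `g = K'U`),
    `r_false_without_allowance` (R with right-hand side `ε` alone is FALSE). LANDED def-free:
    `Theorems/TwSeededEnsembleEquivalenceR/Negative/Allowance.lean` (p117070). SHARPENED (Template H′, NEW this cycle):
    the floor is POLYNOMIAL, `D_L ≥ (2/β)log(1+e^{−1})(16πβ)⁻² − U − 32g` for `L ≥ 16πβ` (`seeded_defect_floor_cube`,
    from a level count `#{k : |ε_L(k) − μ| ≤ a} ≥ (aL/16π)²` valid at EVERY level `μ ∈ [−4,4]`,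
    `sq_le_card_filter_abs_torusBand_sub_le`), so `rWithAllowance_false_of_lt_cube` and
    `r_false_of_allowance_inv_pow_four : ∀ C, ¬ RWithAllowance (C/β⁴)` — the allowance is load-bearing at every
    temperature scale of the window, not only at `β ≈ 1` (LANDED: `…/Negative/LevelCount.lean` p117075, `…/Negative/PolynomialFloor.lean` p117281).
    Reading for provers: there is no "exact" thermal-window ensemble equivalence `D_L → 0` to aim for, at any `β`;
    the free thermal entropy (`≍ γT²/2` in truth, `≥ c₀T³` checked) must be paid from `log 4/β`.
  (H-δlow) `1/10 ≤ δ` — LOAD-BEARING: `rBodyAt_zero_false` (the body at half filling is false against every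
    window ⊂ (−4,0) and every `(a,K',U₀)`: T = 0 hull gap `(|μ|³/(2048π²) − U − 32g)L²` at `N = L²`,
    `hullGap_halfFilling_ge`; witness `β = max 1 (8 log 4/κ)`, `U → 0⁺` with `β ≤ e^{a/U}`, `g = K'U`, even
    `L → ∞`). LANDED def-free: `…/Negative/HalfFilling.lean` (p117072). The thermal window does NOT protect degenerate
    fillings: `U → 0⁺` opens it to every prescribed `β`.
  (H-β≥1) `1 ≤ β` — NOT load-bearing: `r_iff_rPosBeta` (R ⇔ R with `β ∈ (0, e^{a/U}]`), by Template D
    (β-monotonicity, `Negative/BetaMonotonicity`, `twSeededEnsembleEquivalence_instance_anti_beta`). More: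
    R ⇔ its COLDEST SLICE `β = e^{a/U}` (`RCold`; ideator-1 Sketch `r_of_rCold`/`rCold_of_r`, evidence
    20260816T162327Z-Sketch.lean — cited, re-proved here as `r_iff_rCold` for self-containedness).
  (H-βcap) `β ≤ e^{a/U}` and (H-floor) `K'U ≤ g` — the two REPAIR hypotheses. Dropping BOTH returns 1698 as
    filed ⇔ `HullTouchT0Strong` (Negative/HullTouchNormalForm): undecidable by present technique, NOT refuted
    for the t = 1 model (gens 1–4). In the STRUCTURAL class (t = 0, on-site s-wave seed) the β-cap alone does
    not remove the η-pairing counterexample while the seed floor does (`stub_notCruxNarrowShapeAtomicSWave`,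
    Theorems/ThermalWedgeTwSeededEnsembleEquivalenceBarrierNarrow.lean; needs `U/(2g) ∈ (1/2,1)`, excluded by
    any `K' ≥ 1`). For the d-wave t = 1 model neither can be SHOWN load-bearing: that would be a refutation of
    1698-with-one-repair, i.e. a first-order density jump of the weakly repulsive seeded torus — see RESISTS.
  (H-δhigh) `δ ≤ 2/5` — LOAD-BEARING at the far endpoint: `rBodyAt_one_false` (the body at the EMPTY BAND `δ = 1`
    is false: `N_L = 0`, the sector is the vacuum line with `e_L = 0` (`minEnergyOn_seededCan_vacuumSector_nonneg`),
    and `D_L = p_L ≥ −E₀(Hgc μ)/L² ≥ (μ₁+4)(w/(16π))² − U`, `w = min 2 ((μ₁+4)/2)`, from the level count at the band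
    bottom; witness `β = max 1 (8 log 4/κ₀)`, `U → 0⁺` with `β ≤ e^{a/U}`, `g = K'U`, `L ≥ 16π/w`). This is a COLD
    kill through a T = 0 hull gap that is NOT exponentially small in `1/U` — the one executed instance of the
    Template C_R kill shape below. LANDED: `…/Negative/EmptyBand.lean` p117934. So the body of R holds at most on
    `δ ∈ (0,1)`: both window edges `−4 < μ₁`, `μ₂ < 0` are matched to a non-empty, non-half-filled band.
  (H-U₀), (H-window) are the prover's constants — dropping them only weakens R.
* KILL CRITERION FOR R (Template C_R, `r_coldHullDefect_le` / `r_false_of_coldHullGap`): by `Z ≥ e^{−βE₀}` at the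
  cold end `β = e^{a/U}`, R ⟹ for every admissible `(U,g)` some `μ` in the window has, eventually,
      [minE(Hcan, szSector N_L 0) − μN_L − E₀(Hgc μ)]/L² ≤ log 4·e^{−a/U} + κ      (∀ κ > 0),
  i.e. the T = 0 HULL DEFECT of the seeded model at density `1−δ` is at most `log 4·e^{−a/U}` for the PROVER'S
  `a`. Contrapositive = the only kill shape: exhibit `δ` such that for EVERY window and EVERY `a, K', U₀` some
  admissible `(U, g ∈ [K'U,1/10])` has a hull gap `≥ κL²` with `κ > log 4·e^{−a/U}` against every slope of the
  window, frequently in `L`. Since `a > 0` is arbitrary(ly small) and `U ≤ U₀` arbitrary(ly small), A KILL NEEDS A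
  T = 0 HULL GAP AT DENSITY 1−δ ∈ [0.6,0.9] THAT IS NOT EXPONENTIALLY SMALL IN 1/U (e.g. `~U^k`, or g-dependent
  only) at seeds `g ≥ K'U` for every `K'` — equivalently (Template F, `hullGap_coupling_transfer`: the gap per
  site is 1-Lipschitz in `U`, and it VANISHES at `U = 0` where the reduced d-wave BCS model has a strictly
  s-concave Bogoliubov functional, unique optimal source modulus and continuous density, kit j005281/j005486/
  j011869/j018483 of the predecessor seats) a gap `γ(U,g)` with `e^{−a/U} ≪ γ(U,g) ≤ U`. Compare 1698: there ANY
  asymptotic gap `κ > 0` at one admissible `(U,g)` killed (`twSeededEnsembleEquivalence_false_of_hullGapT0`), in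
  particular a Kohn–Luttinger-scale `e^{−c/U²}` jump; R is immune to everything below `e^{−a/U}` ("kill
  asymmetry", lead c2 RESTATE.md) AND to every `g < K'U` phenomenon (the prover raises `K'`).
* WHY R RESISTS (numbers, not adjectives). A gap `γ(U,g) ≫ e^{−a/U}` at `g ∈ [K'U, 1/10]`, `U → 0⁺` means a
  FIRST-ORDER transition (two macroscopically distinct T = 0 states exchanging stability as `μ` crosses `μ*(δ)`)
  of `T − (g/L²)Δ_dᴴΔ_d + U Σ n↑n↓` whose density discontinuity straddles `1−δ` and whose energetic signature
  survives division by... nothing: it must be `≥ U^k`. (i) At `U = 0` there is none for ANY `g` (s ↦ p̃₀(√s)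
  concave: `log cosh(β√(ξ²+8sĝ²)/2)` concave in `s`; unique AHM maximiser, `n(μ) = ∂_μ p` continuous — all β ≤ ∞).
  (ii) Hartree–Fock/Stoner instabilities of the repulsion need `U ≥ 1/max_q χ₀(q,n) = O(1)` on `n ≤ 0.9`
  (j011869(a)) — dodged by `∃ U₀`. (iii) Kohn–Luttinger channel competition (d_xy vs d_x²−y² near n ≈ 0.6) lives
  at scale `e^{−c/U²} ≪ e^{−a/U}` — below R's budget even if first order (and it is continuous at BCS level:
  joint convexity in `(|ψ₁|², |ψ₂|²)`, gen 3). (iv) The one PRINTED seed+repulsion density jump (Bru–de Siqueira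
  Pedra, Rev. Math. Phys. 22 (2010) 233, Thm 4.3: strong-coupling BCS–Hubbard, ZERO hopping, `λ, γ = O(1)`) is
  disjoint from `t = 1 ≫ U`. (v) With `g ≥ K'U` and `K'` free, `U ≤ g/K'`: the repulsion is an arbitrarily small
  RELATIVE perturbation of the seeded BCS model at every admissible seed — the regime where regular
  perturbation theory of the gapped (antinodal) / nodal BCS state predicts smooth μ-dependence. No mechanism, no
  technology for a kill; a proof needs the sourced convergent expansion one μ-derivative deep at fillings
  0.6–0.9 (cruxes 1696/1697's class) + uniqueness of the optimal source modulus — as every seat has said.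
* STRENGTHENINGS checked (for line designers): (S1) allowance `log 4·e^{−9β}` (or any `A(1) < 2log(1+e^{−8})
  ≈ 6.7·10⁻⁴`) — REFUTED (`rWithAllowance_exp_false`); the honest high-T constant is the free thermal excess
  `X(1,n) ≈ 0.7 < 2H₂((1−δ)/2) < log 4` (j011869), so `log 4` has ≈2× slack at β = 1 and a line may NOT assume
  the allowance is tight anywhere. (S2) "μ independent of β on the window" (∃μ ∀β) — NOT refutable and in fact TRUE
  in the free limit with large slack: freezing μ at the COLD optimum μ_F(n) costs D(β, μ_F) − X(β,n) ≤ 0.02 at every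
  β ≥ 1 (table below), while log 4/β − X(β,n) ≥ 0.85/β·… ≥ 0.03 down to β = 50; so a line MAY take μ := μ*(β_U)
  for the whole window (the cold slice fixes μ to accuracy e^{−a/(2U)} anyway: D(β_U, μ) − D(β_U, μ*) ≈ χ(μ−μ*)²/2).
  (S3) two-sided density pinning at fixed μ₀ (secant bracket `hGw`) is STRICTLY STRONGER than R at jump
  endpoints (gen 4 reading (ii)) — a line built on it carries extra risk only in the coexistence scenario.
* NUMERICS (local pure python, 160² k-grid, free band t = 1, file free_defect_numerics.txt = item evidence): the free
  thermal excess X(β,n) = min_μ D and the frozen-μ defect D(β, μ_F(n)):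
      n = 0.9 (μ_F = −0.18): β = 1: X = 0.530, D(μ_F) = 0.534 | β = 2: 0.158/0.160 | β = 5: 0.029/0.030 | β = 20: 0.0019
      n = 0.6 (μ_F = −1.06): β = 1: X = 0.444, D(μ_F) = 0.461 | β = 2: 0.119/0.122 | β = 5: 0.019/0.019 | β = 20: 0.0012
  against log 4/β = 1.386/β and the honest constant 2H₂(n/2)/β = 1.376/β (n=0.9), 1.222/β (n=0.6): βX(β) DEcreases from
  ≈0.53 (β=1) to ≈0.04 (β=20) ≈ γ/(2β) (Sommerfeld), so the sharp allowance constant is c* ≈ 0.53 < log 4 and is attained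
  at β = 1; the checked floors (6.7·10⁻⁴ exponential, 2.5·10⁻⁴/β² polynomial) sit three orders below. μ*(β) drifts from
  −0.34 (β=1) to μ_F = −0.18 (n = 0.9) at a defect cost ≤ 0.004. No kit job (the U = 0 BdG calibrations j005281/j005486/
  j011869/j018483 and bdg-cold-calibration.md of earlier seats cover the seeded solvable corner; no finite-L ED sees e^{−a/U}).

## Targets
(payload.targets / stuck_stubs empty at arming; no line PICKED for this crux yet.)
-/

set_option linter.dupNamespace false

namespace Summit.HubbardSuperconductivity.HubbardSuperconductivity.Cruxes.TwSeededEnsembleEquivalenceR.Disproof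

open Matrix Finset Literature.MathematicalPhysics.QuantumLattice Literature.Probability.LatticeModels
open Summit.HubbardSuperconductivity.HubbardSuperconductivity.Theses.ThermalWedge
open Summit.HubbardSuperconductivity.HubbardSuperconductivity.Theorems.TwSeededEnsembleEquivalence.Negative
open scoped ComplexOrder Matrix.Norms.L2Operator

noncomputable section

/-! ## §-1 Def-free negative lemmas (VERBATIM copies of the files LANDED under
`Theorems/TwSeededEnsembleEquivalenceR/Negative/{Allowance,HalfFilling,LevelCount,PolynomialFloor,EmptyBand}.lean`
(p117070, p117072, p117075, p117281, p117934); kept inline so that this work file elaborates on its own — a later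
generation may replace this section by the five imports) -/

section Landed

/-- **Any allowance below the thermal floor is refuted (repaired crux shape).** If
`A(β₀) < (2/β₀) log(1 + e^{−8β₀})` at some `β₀ ≥ 1`, the variant of `TwSeededEnsembleEquivalenceR` with
entropy allowance `A(β)` in place of `log 4/β` is FALSE. Witness against any `(μ₁,μ₂,a,K',U₀)`: `δ = 1/10`,
`β = β₀`, `U = min U₀ (min (c/4) (min (c/(128K')) (min (1/(10K')) (a/(log β₀ + 1)))))`, `g = K'U`,
`ε = c/4`, `L = max L₀ 3`, where `c > 0` is the gap below the floor. [folklore] -/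
theorem twSeededEnsembleEquivalenceR_false_of_allowance_lt (A : ℝ → ℝ) {β₀ : ℝ} (hβ₀ : 1 ≤ β₀)
    (hA : A β₀ < 2 / β₀ * Real.log (1 + Real.exp (-(8 * β₀)))) :
    ¬ (∀ δ ∈ Set.Icc (1/10 : ℝ) (2/5 : ℝ), ∃ μ₁ μ₂ : ℝ, -4 < μ₁ ∧ μ₁ ≤ μ₂ ∧ μ₂ < 0 ∧
        ∃ a K' U₀ : ℝ, 0 < a ∧ 0 < K' ∧ 0 < U₀ ∧ ∀ U ∈ Set.Ioc (0 : ℝ) U₀, ∀ g ∈ Set.Icc (K' * U) (1 / 10),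
          ∀ β : ℝ, 1 ≤ β → β ≤ Real.exp (a / U) →
            ∃ μ ∈ Set.Icc μ₁ μ₂, ∀ ε : ℝ, 0 < ε → ∃ L₀ : ℕ, ∀ (L : ℕ) [NeZero L], L₀ ≤ L →
              (((hubbardTorus 2 L 1 U - ((g / (L : ℝ) ^ 2 : ℝ) : ℂ) •
                ((pairField dWaveFormFactor L)ᴴ * pairField dWaveFormFactor L))).minEnergyOn
                  (szSector (Λ := FermionTorus 2 L) (2 * ⌊(1 - δ) * (L : ℝ) ^ 2 / 2⌋₊) 0) / (L : ℝ) ^ 2) +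
                (Real.log (Matrix.partitionFn β (hubbardTorusWith 2 L 1 U μ - ((g / (L : ℝ) ^ 2 : ℝ) : ℂ) •
                  ((pairField dWaveFormFactor L)ᴴ * pairField dWaveFormFactor L))).re / (β * (L : ℝ) ^ 2)) -
                μ * ((2 * ⌊(1 - δ) * (L : ℝ) ^ 2 / 2⌋₊) : ℝ) / (L : ℝ) ^ 2 ≤ A β + ε) := by
  intro H
  set c := 2 / β₀ * Real.log (1 + Real.exp (-(8 * β₀))) - A β₀ with hc
  have hcpos : 0 < c := by rw [hc]; linarith
  have hδ : (1/10 : ℝ) ∈ Set.Icc (1/10 : ℝ) (2/5 : ℝ) := ⟨le_rfl, by norm_num⟩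
  obtain ⟨μ₁, μ₂, hμ₁, hμ₁₂, hμ₂, a, K', U₀, ha, hK', hU₀, hU⟩ := H (1/10) hδ
  have hlog : 0 ≤ Real.log β₀ := Real.log_nonneg hβ₀
  have hlog1 : 0 < Real.log β₀ + 1 := by linarith
  -- the witness coupling
  set U : ℝ := min U₀ (min (c / 4) (min (c / (128 * K')) (min (1 / (10 * K')) (a / (Real.log β₀ + 1)))))
    with hUdef
  have hUpos : 0 < U := by
    rw [hUdef]
    refine lt_min hU₀ (lt_min (by positivity) (lt_min (by positivity) (lt_min (by positivity) (by positivity))))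
  have hUU₀ : U ≤ U₀ := min_le_left _ _
  have hUc : U ≤ c / 4 := (min_le_right _ _).trans (min_le_left _ _)
  have hUcK : U ≤ c / (128 * K') := (min_le_right _ _).trans ((min_le_right _ _).trans (min_le_left _ _))
  have hUK : U ≤ 1 / (10 * K') :=
    (min_le_right _ _).trans ((min_le_right _ _).trans ((min_le_right _ _).trans (min_le_left _ _)))
  have hUa : U ≤ a / (Real.log β₀ + 1) :=
    (min_le_right _ _).trans ((min_le_right _ _).trans ((min_le_right _ _).trans (min_le_right _ _)))
  have hUm : U ∈ Set.Ioc (0 : ℝ) U₀ := ⟨hUpos, hUU₀⟩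
  -- the witness seed `g = K'U`
  have hg32 : 32 * (K' * U) ≤ c / 4 := by
    have h := mul_le_mul_of_nonneg_left hUcK hK'.le
    have e : K' * (c / (128 * K')) = c / 128 := by field_simp
    rw [e] at h
    linarith
  have hgm : K' * U ∈ Set.Icc (K' * U) (1 / 10) := by
    refine ⟨le_rfl, ?_⟩
    have h := mul_le_mul_of_nonneg_left hUK hK'.le
    have e : K' * (1 / (10 * K')) = 1 / 10 := by field_simp
    linarith [h, e.le, e.ge]
  -- the witness temperature `β₀ ≤ e^{a/U}`
  have hβexp : β₀ ≤ Real.exp (a / U) := by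
    have h1 : Real.log β₀ ≤ a / U := by
      rw [le_div_iff₀ hUpos]
      have h2 : U * (Real.log β₀ + 1) ≤ a := by
        have := mul_le_mul_of_nonneg_right hUa hlog1.le
        rwa [div_mul_cancel₀ _ hlog1.ne'] at this
      nlinarith
    calc β₀ = Real.exp (Real.log β₀) := (Real.exp_log (lt_of_lt_of_le one_pos hβ₀)).symm
      _ ≤ Real.exp (a / U) := Real.exp_le_exp.2 h1
  obtain ⟨μ, hμm, hμ⟩ := hU U hUm (K' * U) hgm β₀ hβ₀ hβexp
  obtain ⟨L₀, hL₀⟩ := hμ (c / 4) (by positivity)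
  haveI : NeZero (max L₀ 3) := ⟨by omega⟩
  have hinst := hL₀ (max L₀ 3) (le_max_left _ _)
  have hμabs : |μ| ≤ 4 := by
    rw [abs_le]; constructor <;> linarith [hμm.1, hμm.2]
  have hfloor := seeded_defect_floor_crux (max L₀ 3) (le_max_right _ _) (U := U) (g := K' * U)
    (δ := 1/10) hUpos.le (mul_nonneg hK'.le hUpos.le) (lt_of_lt_of_le one_pos hβ₀) hμabs (by norm_num)
  change _ ≤ A β₀ + c / 4 at hinst
  linarith

/-- **The entropy allowance is load-bearing for the repaired crux** (`_false_without_allowance`):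
`TwSeededEnsembleEquivalenceR` with `log 4/β` dropped (right-hand side `ε` alone) is FALSE. Any proof must
spend the allowance — there is no "exact" thermal-window ensemble equivalence `D_L → 0` to aim for. -/
theorem twSeededEnsembleEquivalenceR_false_without_allowance :
    ¬ (∀ δ ∈ Set.Icc (1/10 : ℝ) (2/5 : ℝ), ∃ μ₁ μ₂ : ℝ, -4 < μ₁ ∧ μ₁ ≤ μ₂ ∧ μ₂ < 0 ∧
        ∃ a K' U₀ : ℝ, 0 < a ∧ 0 < K' ∧ 0 < U₀ ∧ ∀ U ∈ Set.Ioc (0 : ℝ) U₀, ∀ g ∈ Set.Icc (K' * U) (1 / 10),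
          ∀ β : ℝ, 1 ≤ β → β ≤ Real.exp (a / U) →
            ∃ μ ∈ Set.Icc μ₁ μ₂, ∀ ε : ℝ, 0 < ε → ∃ L₀ : ℕ, ∀ (L : ℕ) [NeZero L], L₀ ≤ L →
              (((hubbardTorus 2 L 1 U - ((g / (L : ℝ) ^ 2 : ℝ) : ℂ) •
                ((pairField dWaveFormFactor L)ᴴ * pairField dWaveFormFactor L))).minEnergyOn
                  (szSector (Λ := FermionTorus 2 L) (2 * ⌊(1 - δ) * (L : ℝ) ^ 2 / 2⌋₊) 0) / (L : ℝ) ^ 2) +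
                (Real.log (Matrix.partitionFn β (hubbardTorusWith 2 L 1 U μ - ((g / (L : ℝ) ^ 2 : ℝ) : ℂ) •
                  ((pairField dWaveFormFactor L)ᴴ * pairField dWaveFormFactor L))).re / (β * (L : ℝ) ^ 2)) -
                μ * ((2 * ⌊(1 - δ) * (L : ℝ) ^ 2 / 2⌋₊) : ℝ) / (L : ℝ) ^ 2 ≤ ε) := by
  intro H
  refine twSeededEnsembleEquivalenceR_false_of_allowance_lt (fun _ => 0) le_rfl ?_ ?_
  · have : 0 < Real.log (1 + Real.exp (-(8 * (1 : ℝ)))) :=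
      Real.log_pos (by linarith [Real.exp_pos (-(8 * (1:ℝ)))])
    positivity
  · intro δ hδ
    obtain ⟨μ₁, μ₂, hμ₁, hμ₁₂, hμ₂, a, K', U₀, ha, hK', hU₀, hU⟩ := H δ hδ
    refine ⟨μ₁, μ₂, hμ₁, hμ₁₂, hμ₂, a, K', U₀, ha, hK', hU₀, fun U hUm g hg β hβ hβa => ?_⟩
    obtain ⟨μ, hμm, hμ⟩ := hU U hUm g hg β hβ hβa
    refine ⟨μ, hμm, fun ε hε => ?_⟩
    obtain ⟨L₀, hL₀⟩ := hμ ε hε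
    exact ⟨L₀, fun L _ hL => by simpa only [zero_add] using hL₀ L hL⟩


/-- Pure lower bound for seeded sector energies: `minE(H₀(U), K) ≤ minE(Hcan(U,g), K) + 32gL²`
(`K ≠ ⊥`, `g ≥ 0`; `‖Δ_d‖² ≤ 32L⁴`). [folklore] -/
theorem minEnergyOn_pure_le_seededCan_add (L : ℕ) [NeZero L] (U : ℝ) {g : ℝ} (hg : 0 ≤ g)
    (K : Submodule ℂ (Fock (Orb (FermionTorus 2 L)))) (hK : K ≠ ⊥) :
    (hubbardTorus 2 L 1 U).minEnergyOn K ≤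
      (hubbardTorus 2 L 1 U - ((g / (L : ℝ) ^ 2 : ℝ) : ℂ) •
        ((pairField dWaveFormFactor L)ᴴ * pairField dWaveFormFactor L)).minEnergyOn K + 32 * g * (L : ℝ) ^ 2 := by
  obtain ⟨v, hvK, hv0⟩ := (Submodule.ne_bot_iff K).1 hK
  obtain ⟨c, -, hc1⟩ := exists_smul_unit hv0
  rw [← sub_le_iff_le_add]
  refine le_csInf ⟨_, c • v, K.smul_mem c hvK, hc1, rfl⟩ ?_
  rintro E ⟨φ, hφK, hφ1, rfl⟩
  have hH : (hubbardTorus 2 L 1 U).IsHermitian := by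
    rw [← hubbardTorusWith_zero]; exact isHermitian_hubbardTorusWith L 1 U 0
  have h1 := minEnergyOn_le_rayleigh_of_mem hH K hφK hφ1
  have h2 := re_rayleigh_pure_le_Hcan_add L (U := U) hg hφ1
  linarith

/-- `E₀(Hgc(U,μ,g)) ≤ E₀(K⁰_μ) + UL²` for `U, g ≥ 0` (the seed lowers the grand-canonical ground energy, the
repulsion raises it by at most `UL²`). [folklore] -/
theorem groundEnergy_seededGC_le_free_add (L : ℕ) [NeZero L] {U g : ℝ} (hU : 0 ≤ U) (hg : 0 ≤ g) (μ : ℝ) :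
    (hubbardTorusWith 2 L 1 U μ - ((g / (L : ℝ) ^ 2 : ℝ) : ℂ) •
        ((pairField dWaveFormFactor L)ᴴ * pairField dWaveFormFactor L)).groundEnergy ≤
      (hubbardTorusWith 2 L 1 0 μ).groundEnergy + U * (L : ℝ) ^ 2 := by
  have h1 := groundEnergy_seededGC_anti L 0 μ (g₀ := 0) hg
  have h2 := groundEnergy_seededGC_le_add_U L hU μ g
  have h0 : hubbardTorusWith 2 L 1 0 μ - ((0 / (L : ℝ) ^ 2 : ℝ) : ℂ) •
      ((pairField dWaveFormFactor L)ᴴ * pairField dWaveFormFactor L) = hubbardTorusWith 2 L 1 0 μ := by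
    rw [zero_div, Complex.ofReal_zero, zero_smul, sub_zero]
  rw [h0] at h1
  rw [sub_zero] at h2
  linarith

/-- **TEMPLATE I — THE HULL GAP AT HALF FILLING** (d-wave-seeded repulsive torus). For even `L ≥ 3`,
`U, g ≥ 0`, a slope `−4 ≤ μ < 0` with `1 ≤ (|μ|/2)L/(16π)` and every sector `K ≠ ⊥` of `L²`-particle vectors:
`minE(Hcan(U,g), K) − μL² − E₀(Hgc(U,μ,g)) ≥ (|μ|³/(2048π²) − U − 32g)·L²`. [folklore] -/
theorem hullGap_halfFilling_ge (L : ℕ) [NeZero L] (hL3 : 3 ≤ L) (hLe : Even L) {U g μ : ℝ} (hU : 0 ≤ U)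
    (hg : 0 ≤ g) (hμ : μ < 0) (hμ4 : -4 ≤ μ) (hLm : 1 ≤ -μ / 2 * L / (16 * Real.pi))
    (K : Submodule ℂ (Fock (Orb (FermionTorus 2 L)))) (hK : K ≠ ⊥) (hKN : ∀ ψ ∈ K, IsNParticle (L ^ 2) ψ) :
    ((-μ) ^ 3 / (2048 * Real.pi ^ 2) - U - 32 * g) * (L : ℝ) ^ 2 ≤
      (hubbardTorus 2 L 1 U - ((g / (L : ℝ) ^ 2 : ℝ) : ℂ) •
          ((pairField dWaveFormFactor L)ᴴ * pairField dWaveFormFactor L)).minEnergyOn K - μ * (L : ℝ) ^ 2 -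
        (hubbardTorusWith 2 L 1 U μ - ((g / (L : ℝ) ^ 2 : ℝ) : ℂ) •
          ((pairField dWaveFormFactor L)ᴴ * pairField dWaveFormFactor L)).groundEnergy := by
  have hLpos : (0 : ℝ) < (L : ℝ) ^ 2 := cast_sq_pos_of_neZero L
  -- (U, g) → (0, g) → (0, 0) on the sector side
  have h1 := minEnergyOn_seededCan_mono_U L hU g K hK
  have h2 := minEnergyOn_pure_le_seededCan_add L 0 hg K hK
  -- trivial half at U = g = μ = 0
  have h3 := groundEnergy_seededGC_add_le_minEnergyOn L 0 0 0 K hK hKN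
  have h3' : (hubbardTorusWith 2 L 1 0 0).groundEnergy ≤ (hubbardTorus 2 L 1 0).minEnergyOn K := by
    have e1 : hubbardTorusWith 2 L 1 0 0 - ((0 / (L : ℝ) ^ 2 : ℝ) : ℂ) •
        ((pairField dWaveFormFactor L)ᴴ * pairField dWaveFormFactor L) = hubbardTorusWith 2 L 1 0 0 := by
      rw [zero_div, Complex.ofReal_zero, zero_smul, sub_zero]
    have e2 : hubbardTorus 2 L 1 0 - ((0 / (L : ℝ) ^ 2 : ℝ) : ℂ) •
        ((pairField dWaveFormFactor L)ᴴ * pairField dWaveFormFactor L) = hubbardTorus 2 L 1 0 := by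
      rw [zero_div, Complex.ofReal_zero, zero_smul, sub_zero]
    rw [e1, e2, zero_mul, add_zero] at h3
    exact h3
  -- (U, g) → (0, 0) on the grand-canonical side
  have h4 := groundEnergy_seededGC_le_free_add L hU hg μ
  rw [groundEnergy_hubbardTorusWith_zero hL3 0] at h3'
  rw [groundEnergy_hubbardTorusWith_zero hL3 μ] at h4
  set m : ℝ := -μ with hm
  have hm0 : 0 ≤ m := by rw [hm]; linarith
  have hsub : ∀ k : TorusSite 2 L, torusBand L k - μ = torusBand L k + m := fun k => by rw [hm]; ring
  simp only [sub_zero] at h3'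
  simp only [hsub] at h4
  -- the free count at half filling
  have h5 := free_legendre_defect_halfFilling_ge hLe hm0
  have h6 := sq_le_card_filter_abs_torusBand_le (L := L) (a := m / 2) (by rw [hm]; linarith)
    (by rw [hm]; linarith) hLm
  have hcnt : m ^ 3 / (2048 * Real.pi ^ 2) * (L : ℝ) ^ 2 ≤
      m / 2 * ((Finset.univ.filter fun k : TorusSite 2 L => |torusBand L k| ≤ m / 2).card : ℝ) := by
    have : m / 2 * (m / 2 * L / (16 * Real.pi)) ^ 2 = m ^ 3 / (2048 * Real.pi ^ 2) * (L : ℝ) ^ 2 := by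
      field_simp; ring
    rw [← this]
    exact mul_le_mul_of_nonneg_left h6 (by positivity)
  linarith [h1, h2, h3', h4, h5, hcnt, hLpos, hm]

/-- The crux's particle number at `δ = 0` and even `L`: `2⌊(1 − 0)L²/2⌋₊ = L²`. -/
theorem two_mul_floor_halfFilling_of_even {L : ℕ} (hL : Even L) :
    2 * ⌊(1 - (0 : ℝ)) * (L : ℝ) ^ 2 / 2⌋₊ = L ^ 2 := by
  obtain ⟨M, hM⟩ := hL
  have h : (1 - (0 : ℝ)) * (L : ℝ) ^ 2 / 2 = ((2 * M ^ 2 : ℕ) : ℝ) := by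
    rw [hM]; push_cast; ring
  rw [h, Nat.floor_natCast, hM]; ring

/-- **Template I, kill form for the repaired crux: the doping window is load-bearing.** The BODY of
`TwSeededEnsembleEquivalenceR` at `δ = 0` (half filling) is FALSE: for every window `[μ₁,μ₂] ⊂ (−4,0)` and
every `(a, K', U₀)`, the disprover's `β = max 1 (8 log 4/κ)`, `U → 0⁺` (with `β ≤ e^{a/U}`), `g = K'U` and
even `L → ∞` (`κ = |μ₂|³/(2048π²)`) violate the inequality. The thermal window does not help: it opens to
every prescribed `β` as `U → 0⁺`. [folklore] -/
theorem twSeededEnsembleEquivalenceR_body_false_at_halfFilling :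
    ¬ (∃ μ₁ μ₂ : ℝ, -4 < μ₁ ∧ μ₁ ≤ μ₂ ∧ μ₂ < 0 ∧
        ∃ a K' U₀ : ℝ, 0 < a ∧ 0 < K' ∧ 0 < U₀ ∧ ∀ U ∈ Set.Ioc (0 : ℝ) U₀, ∀ g ∈ Set.Icc (K' * U) (1 / 10),
          ∀ β : ℝ, 1 ≤ β → β ≤ Real.exp (a / U) →
            ∃ μ ∈ Set.Icc μ₁ μ₂, ∀ ε : ℝ, 0 < ε → ∃ L₀ : ℕ, ∀ (L : ℕ) [NeZero L], L₀ ≤ L →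
              (((hubbardTorus 2 L 1 U - ((g / (L : ℝ) ^ 2 : ℝ) : ℂ) •
                ((pairField dWaveFormFactor L)ᴴ * pairField dWaveFormFactor L))).minEnergyOn
                  (szSector (Λ := FermionTorus 2 L) (2 * ⌊(1 - (0 : ℝ)) * (L : ℝ) ^ 2 / 2⌋₊) 0) / (L : ℝ) ^ 2) +
                (Real.log (Matrix.partitionFn β (hubbardTorusWith 2 L 1 U μ - ((g / (L : ℝ) ^ 2 : ℝ) : ℂ) •
                  ((pairField dWaveFormFactor L)ᴴ * pairField dWaveFormFactor L))).re / (β * (L : ℝ) ^ 2)) -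
                μ * ((2 * ⌊(1 - (0 : ℝ)) * (L : ℝ) ^ 2 / 2⌋₊) : ℝ) / (L : ℝ) ^ 2 ≤ Real.log 4 / β + ε) := by
  rintro ⟨μ₁, μ₂, hμ₁, hμ₁₂, hμ₂, a, K', U₀, ha, hK', hU₀, H⟩
  have hπ := Real.pi_pos
  set m : ℝ := -μ₂ with hmdef
  have hm : 0 < m := by rw [hmdef]; linarith
  set κ : ℝ := m ^ 3 / (2048 * Real.pi ^ 2) with hκ
  have hκpos : 0 < κ := by positivity
  -- the witness temperature
  set β : ℝ := max 1 (8 * Real.log 4 / κ) with hβdef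
  have hβ1 : 1 ≤ β := le_max_left _ _
  have hβpos : 0 < β := lt_of_lt_of_le one_pos hβ1
  have hlog4 : 0 < Real.log 4 := Real.log_pos (by norm_num)
  have hslack : Real.log 4 / β ≤ κ / 8 := by
    rw [div_le_iff₀ hβpos]
    have : 8 * Real.log 4 / κ ≤ β := le_max_right _ _
    rw [div_le_iff₀ hκpos] at this
    linarith
  have hlog : 0 ≤ Real.log β := Real.log_nonneg hβ1
  have hlog1 : 0 < Real.log β + 1 := by linarith
  -- the witness coupling `U → 0⁺` and seed `g = K'U`
  set U : ℝ := min U₀ (min (κ / 4) (min (κ / (128 * K')) (min (1 / (10 * K')) (a / (Real.log β + 1)))))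
    with hUdef
  have hUpos : 0 < U := by
    rw [hUdef]
    refine lt_min hU₀ (lt_min (by positivity) (lt_min (by positivity) (lt_min (by positivity) (by positivity))))
  have hUU₀ : U ≤ U₀ := min_le_left _ _
  have hUκ : U ≤ κ / 4 := (min_le_right _ _).trans (min_le_left _ _)
  have hUκK : U ≤ κ / (128 * K') := (min_le_right _ _).trans ((min_le_right _ _).trans (min_le_left _ _))
  have hUK : U ≤ 1 / (10 * K') :=
    (min_le_right _ _).trans ((min_le_right _ _).trans ((min_le_right _ _).trans (min_le_left _ _)))
  have hUa : U ≤ a / (Real.log β + 1) :=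
    (min_le_right _ _).trans ((min_le_right _ _).trans ((min_le_right _ _).trans (min_le_right _ _)))
  have hUm : U ∈ Set.Ioc (0 : ℝ) U₀ := ⟨hUpos, hUU₀⟩
  have hg32 : 32 * (K' * U) ≤ κ / 4 := by
    have h := mul_le_mul_of_nonneg_left hUκK hK'.le
    have e : K' * (κ / (128 * K')) = κ / 128 := by field_simp
    rw [e] at h
    linarith
  have hgm : K' * U ∈ Set.Icc (K' * U) (1 / 10) := by
    refine ⟨le_rfl, ?_⟩
    have h := mul_le_mul_of_nonneg_left hUK hK'.le
    have e : K' * (1 / (10 * K')) = 1 / 10 := by field_simp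
    linarith [h, e.le, e.ge]
  have hβexp : β ≤ Real.exp (a / U) := by
    have h1 : Real.log β ≤ a / U := by
      rw [le_div_iff₀ hUpos]
      have h2 : U * (Real.log β + 1) ≤ a := by
        have := mul_le_mul_of_nonneg_right hUa hlog1.le
        rwa [div_mul_cancel₀ _ hlog1.ne'] at this
      nlinarith
    calc β = Real.exp (Real.log β) := (Real.exp_log hβpos).symm
      _ ≤ Real.exp (a / U) := Real.exp_le_exp.2 h1
  obtain ⟨μ, hμm, hμ⟩ := H U hUm (K' * U) hgm β hβ1 hβexp
  obtain ⟨L₀, hL₀⟩ := hμ (κ / 8) (by positivity)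
  -- an even side `L ≥ max(L₀, 64π/m, 4)`
  obtain ⟨L₁, hL₁⟩ := exists_nat_gt (64 * Real.pi / m)
  set L : ℕ := 2 * (max (max L₀ L₁) 2) with hLdef
  have hLe : Even L := ⟨max (max L₀ L₁) 2, by rw [hLdef]; ring⟩
  have hL0le : L₀ ≤ L := by
    have : L₀ ≤ max (max L₀ L₁) 2 := (le_max_left _ _).trans (le_max_left _ _)
    omega
  have hL4 : 4 ≤ L := by have : 2 ≤ max (max L₀ L₁) 2 := le_max_right _ _; omega
  have hL1le : (L₁ : ℝ) ≤ L := by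
    have : L₁ ≤ L := by
      have : L₁ ≤ max (max L₀ L₁) 2 := (le_max_right _ _).trans (le_max_left _ _)
      omega
    exact_mod_cast this
  haveI : NeZero L := ⟨by omega⟩
  have hLr : (0 : ℝ) < L := by exact_mod_cast (show 0 < L by omega)
  have hLpos : (0 : ℝ) < (L : ℝ) ^ 2 := cast_sq_pos_of_neZero L
  have hinst := hL₀ L hL0le
  have hμneg : μ < 0 := lt_of_le_of_lt hμm.2 hμ₂
  have hμ4 : -4 ≤ μ := by linarith [hμm.1]
  have hmle : m ≤ -μ := by rw [hmdef]; linarith [hμm.2]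
  have hLm : 1 ≤ -μ / 2 * L / (16 * Real.pi) := by
    rw [le_div_iff₀ (by positivity)]
    have h1 : 64 * Real.pi / m < L := hL₁.trans_le hL1le
    rw [div_lt_iff₀ hm] at h1
    nlinarith [mul_nonneg (sub_nonneg.2 hmle) hLr.le]
  -- the sector at δ = 0 is the half-filled one, `N = L²`
  have hNL : 2 * ⌊(1 - (0 : ℝ)) * (L : ℝ) ^ 2 / 2⌋₊ = L ^ 2 := two_mul_floor_halfFilling_of_even hLe
  have hNLr : (2 : ℝ) * (⌊(1 - (0 : ℝ)) * (L : ℝ) ^ 2 / 2⌋₊ : ℝ) = (L : ℝ) ^ 2 := by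
    have h : ((2 * ⌊(1 - (0 : ℝ)) * (L : ℝ) ^ 2 / 2⌋₊ : ℕ) : ℝ) = ((L ^ 2 : ℕ) : ℝ) := by rw [hNL]
    push_cast at h
    linarith
  have hKne : szSector (Λ := FermionTorus 2 L) (L ^ 2) 0 ≠ ⊥ := by
    obtain ⟨M, hM⟩ := hLe
    have hsq : L ^ 2 = 2 * (2 * M ^ 2) := by rw [hM]; ring
    have hn : 2 * M ^ 2 ≤ Fintype.card (FermionTorus 2 L) := by rw [card_fermionTorus, hsq]; omega
    obtain ⟨⟨ψ, hψS, hψ0, -⟩, -⟩ := szSector_groundState (fermionTorusGraph 2 L) 1 0 hn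
    rw [hsq, Submodule.ne_bot_iff]
    exact ⟨ψ, hψS, hψ0⟩
  have hKN : ∀ ψ ∈ szSector (Λ := FermionTorus 2 L) (L ^ 2) 0, IsNParticle (L ^ 2) ψ :=
    fun ψ hψ => ((mem_szSector_iff _ _ ψ).1 hψ).1
  have hgap := hullGap_halfFilling_ge L (by omega) hLe (U := U) (g := K' * U) hUpos.le
    (mul_nonneg hK'.le hUpos.le) hμneg hμ4 hLm (szSector (Λ := FermionTorus 2 L) (L ^ 2) 0) hKne hKN
  rw [hNL, hNLr] at hinst
  set A := (hubbardTorus 2 L 1 U - ((K' * U / (L : ℝ) ^ 2 : ℝ) : ℂ) •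
      ((pairField dWaveFormFactor L)ᴴ * pairField dWaveFormFactor L)).minEnergyOn
      (szSector (Λ := FermionTorus 2 L) (L ^ 2) 0) with hA
  have hZ : -(β * (hubbardTorusWith 2 L 1 U μ - ((K' * U / (L : ℝ) ^ 2 : ℝ) : ℂ) •
      ((pairField dWaveFormFactor L)ᴴ * pairField dWaveFormFactor L)).groundEnergy) ≤
      Real.log ((hubbardTorusWith 2 L 1 U μ - ((K' * U / (L : ℝ) ^ 2 : ℝ) : ℂ) •
      ((pairField dWaveFormFactor L)ᴴ * pairField dWaveFormFactor L)).partitionFn β).re :=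
    neg_mul_groundEnergy_le_log_partitionFn (isHermitian_seededGC L U μ (K' * U)) β
  set E := (hubbardTorusWith 2 L 1 U μ - ((K' * U / (L : ℝ) ^ 2 : ℝ) : ℂ) •
      ((pairField dWaveFormFactor L)ᴴ * pairField dWaveFormFactor L)).groundEnergy with hE
  set Z := Real.log ((hubbardTorusWith 2 L 1 U μ - ((K' * U / (L : ℝ) ^ 2 : ℝ) : ℂ) •
      ((pairField dWaveFormFactor L)ᴴ * pairField dWaveFormFactor L)).partitionFn β).re with hZdef
  have hZ' : -(E / (L : ℝ) ^ 2) ≤ Z / (β * (L : ℝ) ^ 2) := by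
    rw [le_div_iff₀ (mul_pos hβpos hLpos)]
    have : -(E / (L : ℝ) ^ 2) * (β * (L : ℝ) ^ 2) = -(β * E) := by
      field_simp
    linarith
  have hκ' : κ ≤ (-μ) ^ 3 / (2048 * Real.pi ^ 2) := by
    rw [hκ]; apply div_le_div_of_nonneg_right _ (by positivity)
    exact pow_le_pow_left₀ hm.le hmle 3
  have hgap' : κ / 2 ≤ A / (L : ℝ) ^ 2 - μ - E / (L : ℝ) ^ 2 := by
    have h1 : (κ / 2) * (L : ℝ) ^ 2 ≤ A - μ * (L : ℝ) ^ 2 - E := by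
      refine le_trans ?_ hgap
      apply mul_le_mul_of_nonneg_right _ hLpos.le
      linarith
    have h2 := div_le_div_of_nonneg_right h1 hLpos.le
    rw [mul_div_assoc, div_self hLpos.ne', mul_one] at h2
    have e : (A - μ * (L : ℝ) ^ 2 - E) / (L : ℝ) ^ 2 = A / (L : ℝ) ^ 2 - μ - E / (L : ℝ) ^ 2 := by
      field_simp
    rw [e] at h2
    exact h2
  have hinst' : A / (L : ℝ) ^ 2 + Z / (β * (L : ℝ) ^ 2) - μ * (L : ℝ) ^ 2 / (L : ℝ) ^ 2 ≤
      Real.log 4 / β + κ / 8 := hinst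
  rw [mul_div_assoc, div_self hLpos.ne', mul_one] at hinst'
  linarith

/-! ### (inlined) LevelCount.lean + PolynomialFloor.lean — Template H′, the polynomial floor `c₀/β³` -/

/-! ### A box of momenta at an arbitrary level of the band -/

section Band

variable {L : ℕ} [NeZero L]

/-- On the box `j₀ ≤ k_i ≤ j₀ + J` with `θ ≤ 2πj₀/L ≤ θ + 2π/L`, every angle is within `2π(J+1)/L` of `θ`, hence
`|ε_L(k) + 4cos θ| ≤ 8π(J+1)/L` (`cos` is 1-Lipschitz). [folklore] -/
theorem abs_torusBand_sub_level_le_of_box (θ : ℝ) (j₀ J : ℕ)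
    (hlo : θ ≤ 2 * Real.pi * j₀ / L) (hhi : 2 * Real.pi * j₀ / L ≤ θ + 2 * Real.pi / L)
    (k : TorusSite 2 L) (hk : ∀ i : Fin 2, j₀ ≤ (k i).val ∧ (k i).val ≤ j₀ + J) :
    |torusBand L k + 4 * Real.cos θ| ≤ 8 * Real.pi * (J + 1) / L := by
  have hL0 : 0 < L := Nat.pos_of_ne_zero (NeZero.ne L)
  have hLr : (0 : ℝ) < L := by exact_mod_cast hL0
  have hπ := Real.pi_pos
  set T : ℝ := 2 * Real.pi * (J + 1) / L with hT
  have hT0 : 0 ≤ T := by positivity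
  have hang : ∀ x : ℕ, j₀ ≤ x → x ≤ j₀ + J → |2 * Real.pi * (x : ℝ) / L - θ| ≤ T := by
    intro x hx1 hx2
    have hx1r : (j₀ : ℝ) ≤ x := by exact_mod_cast hx1
    have hx2r : (x : ℝ) ≤ j₀ + J := by exact_mod_cast hx2
    rw [abs_le]
    constructor
    · have h1 : 2 * Real.pi * (j₀ : ℝ) / L ≤ 2 * Real.pi * (x : ℝ) / L :=
        div_le_div_of_nonneg_right (by nlinarith) hLr.le
      linarith
    · have h1 : 2 * Real.pi * (x : ℝ) / L ≤ 2 * Real.pi * (j₀ : ℝ) / L + 2 * Real.pi * (J : ℝ) / L := by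
        rw [← add_div, div_le_div_iff_of_pos_right hLr]
        nlinarith
      have h2 : T = 2 * Real.pi / L + 2 * Real.pi * (J : ℝ) / L := by
        rw [hT, ← add_div]; ring
      linarith
  have hcos : ∀ x : ℕ, j₀ ≤ x → x ≤ j₀ + J →
      |Real.cos (2 * Real.pi * (x : ℝ) / L) - Real.cos θ| ≤ T :=
    fun x hx1 hx2 => (Real.abs_cos_sub_cos_le _ _).trans (hang x hx1 hx2)
  have hc0 := hcos (k 0).val (hk 0).1 (hk 0).2
  have hc1 := hcos (k 1).val (hk 1).1 (hk 1).2
  have hband : torusBand L k =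
      -2 * (Real.cos (2 * Real.pi * ((k 0).val : ℝ) / L) + Real.cos (2 * Real.pi * ((k 1).val : ℝ) / L)) := by
    simp only [torusBand, Fin.sum_univ_two, latticeMomentum_apply]
  rw [hband]
  have e : -2 * (Real.cos (2 * Real.pi * ((k 0).val : ℝ) / L) + Real.cos (2 * Real.pi * ((k 1).val : ℝ) / L)) +
      4 * Real.cos θ =
      (-2) * ((Real.cos (2 * Real.pi * ((k 0).val : ℝ) / L) - Real.cos θ) +
        (Real.cos (2 * Real.pi * ((k 1).val : ℝ) / L) - Real.cos θ)) := by ring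
  rw [e, abs_mul]
  have h3 := abs_add_le (Real.cos (2 * Real.pi * ((k 0).val : ℝ) / L) - Real.cos θ)
    (Real.cos (2 * Real.pi * ((k 1).val : ℝ) / L) - Real.cos θ)
  have h2 : |(-2 : ℝ)| = 2 := by norm_num
  rw [h2]
  calc 2 * |(Real.cos (2 * Real.pi * ((k 0).val : ℝ) / L) - Real.cos θ) +
        (Real.cos (2 * Real.pi * ((k 1).val : ℝ) / L) - Real.cos θ)| ≤ 2 * (T + T) := by
        nlinarith [h3, hc0, hc1]
    _ = 8 * Real.pi * (J + 1) / L := by rw [hT]; ring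

/-- **Level box count**: for `0 ≤ θ ≤ π` and `2(J+1) + 4 ≤ L`, at least `(J+1)²` momenta have
`|ε_L(k) + 4cos θ| ≤ 8π(J+1)/L` (the box `(j₀ + p, j₀ + q)`, `p, q ≤ J`, `j₀ = ⌈θL/(2π)⌉`). [folklore] -/
theorem sq_le_card_filter_abs_torusBand_sub_level_small (θ : ℝ) (hθ0 : 0 ≤ θ) (hθπ : θ ≤ Real.pi) (J : ℕ)
    (hJ : 2 * (J + 1) + 4 ≤ L) :
    (J + 1) ^ 2 ≤ (Finset.univ.filter fun k : TorusSite 2 L =>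
      |torusBand L k + 4 * Real.cos θ| ≤ 8 * Real.pi * (J + 1) / L).card := by
  classical
  have hL0 : 0 < L := Nat.pos_of_ne_zero (NeZero.ne L)
  have hLr : (0 : ℝ) < L := by exact_mod_cast hL0
  have hπ := Real.pi_pos
  set j₀ : ℕ := ⌈θ * L / (2 * Real.pi)⌉₊ with hj₀
  have hx0 : 0 ≤ θ * L / (2 * Real.pi) := by positivity
  have hj₀lt : (j₀ : ℝ) < θ * L / (2 * Real.pi) + 1 := Nat.ceil_lt_add_one hx0
  have hj₀ge : θ * L / (2 * Real.pi) ≤ j₀ := Nat.le_ceil _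
  have hhalf : θ * L / (2 * Real.pi) ≤ L / 2 := by
    rw [div_le_div_iff₀ (by positivity) (by norm_num)]
    nlinarith
  have hjJ : j₀ + J < L := by
    have h2 : (2 * (J + 1) + 4 : ℝ) ≤ L := by exact_mod_cast hJ
    have : (j₀ : ℝ) + J < L := by linarith
    exact_mod_cast this
  have hlo : θ ≤ 2 * Real.pi * j₀ / L := by
    rw [le_div_iff₀ hLr]
    rw [div_le_iff₀ (by positivity)] at hj₀ge
    linarith
  have hhi : 2 * Real.pi * j₀ / L ≤ θ + 2 * Real.pi / L := by
    have e : θ + 2 * Real.pi / L = (θ * L + 2 * Real.pi) / L := by field_simp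
    rw [e, div_le_div_iff_of_pos_right hLr]
    have h5 : ((j₀ : ℝ) - 1) * (2 * Real.pi) < θ * L := by
      have := sub_lt_iff_lt_add.2 hj₀lt
      rwa [lt_div_iff₀ (by positivity)] at this
    nlinarith
  set F : ℕ × ℕ → TorusSite 2 L := fun p i => if i = 0 then ((j₀ + p.1 : ℕ) : ZMod L) else ((j₀ + p.2 : ℕ) : ZMod L)
    with hF
  have hF0 : ∀ p : ℕ × ℕ, j₀ + p.1 < L → (F p 0).val = j₀ + p.1 := fun p hp => by
    show ((j₀ + p.1 : ℕ) : ZMod L).val = j₀ + p.1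
    rw [ZMod.val_natCast, Nat.mod_eq_of_lt hp]
  have hF1 : ∀ p : ℕ × ℕ, j₀ + p.2 < L → (F p 1).val = j₀ + p.2 := fun p hp => by
    show (if (1 : Fin 2) = 0 then ((j₀ + p.1 : ℕ) : ZMod L) else ((j₀ + p.2 : ℕ) : ZMod L)).val = j₀ + p.2
    rw [if_neg (by decide), ZMod.val_natCast, Nat.mod_eq_of_lt hp]
  set S := (Finset.range (J + 1)) ×ˢ (Finset.range (J + 1)) with hS
  have hinj : Set.InjOn F S := by
    intro p hp p' hp' heq
    simp only [hS, Finset.coe_product, Finset.coe_range, Set.mem_prod, Set.mem_Iio] at hp hp'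
    have e0 := congrArg ZMod.val (congrFun heq 0)
    have e1 := congrArg ZMod.val (congrFun heq 1)
    rw [hF0 p (by omega), hF0 p' (by omega)] at e0
    rw [hF1 p (by omega), hF1 p' (by omega)] at e1
    exact Prod.ext (by omega) (by omega)
  have hcard : (S.image F).card = (J + 1) ^ 2 := by
    rw [Finset.card_image_of_injOn hinj, hS, Finset.card_product, Finset.card_range, sq]
  rw [← hcard]
  refine Finset.card_le_card fun k hk => ?_
  rw [Finset.mem_image] at hk
  obtain ⟨p, hp, rfl⟩ := hk
  simp only [hS, Finset.mem_product, Finset.mem_range] at hp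
  rw [Finset.mem_filter]
  refine ⟨Finset.mem_univ _, abs_torusBand_sub_level_le_of_box θ j₀ J hlo hhi (F p) fun i => ?_⟩
  fin_cases i
  · show j₀ ≤ (F p 0).val ∧ (F p 0).val ≤ j₀ + J
    rw [hF0 p (by omega)]; omega
  · show j₀ ≤ (F p 1).val ∧ (F p 1).val ≤ j₀ + J
    rw [hF1 p (by omega)]; omega

/-- **Extensive count at every level of the band**: for `|ν| ≤ 4`, `0 < a ≤ 2` and `1 ≤ aL/(16π)`:
`#{k : |ε_L(k) − ν| ≤ a} ≥ (aL/(16π))²`. [folklore] -/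
theorem sq_le_card_filter_abs_torusBand_sub_le {ν a : ℝ} (hν : |ν| ≤ 4) (ha : 0 < a) (ha2 : a ≤ 2)
    (hL : 1 ≤ a * L / (16 * Real.pi)) :
    (a * L / (16 * Real.pi)) ^ 2 ≤
      ((Finset.univ.filter fun k : TorusSite 2 L => |torusBand L k - ν| ≤ a).card : ℝ) := by
  have hL0 : 0 < L := Nat.pos_of_ne_zero (NeZero.ne L)
  have hLr : (0 : ℝ) < L := by exact_mod_cast hL0
  have hπ := Real.pi_pos
  have hπ3 := Real.pi_gt_three
  -- the level angle
  rw [abs_le] at hν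
  set θ : ℝ := Real.arccos (-ν / 4) with hθ
  have hcosθ : Real.cos θ = -ν / 4 := by
    rw [hθ, Real.cos_arccos (by linarith) (by linarith)]
  have hθ0 : 0 ≤ θ := Real.arccos_nonneg _
  have hθπ : θ ≤ Real.pi := Real.arccos_le_pi _
  -- the box size
  set n : ℕ := ⌊a * L / (8 * Real.pi)⌋₊ with hn
  have hx0 : 0 ≤ a * L / (8 * Real.pi) := by positivity
  have hnle : (n : ℝ) ≤ a * L / (8 * Real.pi) := Nat.floor_le hx0
  have hnge : a * L / (8 * Real.pi) - 1 ≤ n := by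
    have := Nat.lt_floor_add_one (a * L / (8 * Real.pi)); rw [← hn] at this; linarith
  have h2 : a * L / (8 * Real.pi) = 2 * (a * L / (16 * Real.pi)) := by
    rw [mul_div_assoc' 2, div_eq_div_iff (by positivity) (by positivity)]; ring
  have hn1 : (1 : ℝ) ≤ n := by linarith
  have hn1' : 1 ≤ n := by exact_mod_cast hn1
  -- 2 n + 4 ≤ L
  have hL24 : (24 : ℝ) < L := by
    rw [le_div_iff₀ (by positivity)] at hL
    have : a * L ≤ 2 * L := by nlinarith
    nlinarith
  have h2n : 2 * (n - 1 + 1) + 4 ≤ L := by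
    rw [Nat.sub_add_cancel hn1']
    have : 2 * (n : ℝ) + 4 ≤ L := by
      have e8 : 8 * (a * L / (8 * Real.pi)) = a * L / Real.pi := by
        rw [mul_div_assoc' 8, div_eq_div_iff (by positivity) (by positivity)]; ring
      have h3 : a * L / Real.pi ≤ 2 * L / 3 := by
        rw [div_le_div_iff₀ hπ (by norm_num)]; nlinarith
      linarith
    exact_mod_cast this
  have hbox := sq_le_card_filter_abs_torusBand_sub_level_small (L := L) θ hθ0 hθπ (n - 1) h2n
  rw [Nat.sub_add_cancel hn1'] at hbox
  -- the box levels satisfy |ε − ν| ≤ 8π n/L ≤ a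
  have hthr : 8 * Real.pi * ((n - 1 : ℕ) + 1 : ℝ) / L ≤ a := by
    have : ((n - 1 : ℕ) : ℝ) + 1 = n := by
      rw [Nat.cast_sub hn1']; push_cast; ring
    rw [this, div_le_iff₀ hLr]
    have := mul_le_mul_of_nonneg_left hnle (by positivity : (0 : ℝ) ≤ 8 * Real.pi)
    have h4 : 8 * Real.pi * (a * L / (8 * Real.pi)) = a * L := by field_simp
    linarith
  have hsub : (Finset.univ.filter fun k : TorusSite 2 L =>
      |torusBand L k + 4 * Real.cos θ| ≤ 8 * Real.pi * ((n - 1 : ℕ) + 1) / L) ⊆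
      (Finset.univ.filter fun k : TorusSite 2 L => |torusBand L k - ν| ≤ a) := by
    intro k hk
    rw [Finset.mem_filter] at hk ⊢
    refine ⟨hk.1, ?_⟩
    have e : torusBand L k - ν = torusBand L k + 4 * Real.cos θ := by rw [hcosθ]; ring
    rw [e]
    exact hk.2.trans hthr
  have hcardle := Finset.card_le_card hsub
  have : ((n : ℝ)) ^ 2 ≤ ((Finset.univ.filter fun k : TorusSite 2 L => |torusBand L k - ν| ≤ a).card : ℝ) := by
    have := hbox.trans hcardle
    exact_mod_cast this
  have hn2 : a * L / (16 * Real.pi) ≤ n := by linarith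
  calc (a * L / (16 * Real.pi)) ^ 2 ≤ (n : ℝ) ^ 2 := pow_le_pow_left₀ (by positivity) hn2 2
    _ ≤ _ := this

end Band



/-! ### The refined free floor: entropy of the levels within `a` of the Fermi level -/

/-- **Free thermal entropy near the level.** For `L ≥ 3`, `β ≥ 0`, every `μ` and every `a`:
`−2β Σ_k min(ε_L(k) − μ, 0) + 2 log(1 + e^{−βa})·#{k : |ε_L(k) − μ| ≤ a} ≤ log Re Z_β(hubbardTorusWith 2 L 1 0 μ)`. [folklore] -/
theorem log_partitionFn_free_torus_ge_level (L : ℕ) [NeZero L] (hL : 3 ≤ L) {β : ℝ} (hβ : 0 ≤ β) (μ a : ℝ) :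
    -(2 * β * ∑ k : TorusSite 2 L, min (torusBand L k - μ) 0) +
        2 * Real.log (1 + Real.exp (-(β * a))) *
          ((Finset.univ.filter fun k : TorusSite 2 L => |torusBand L k - μ| ≤ a).card : ℝ) ≤
      Real.log (partitionFn β (hubbardTorusWith 2 L 1 0 μ)).re := by
  classical
  have hZ := partitionFn_dWaveSourceTorus_zero_re hL β μ 0
  rw [dWaveSourceTorus_zero] at hZ
  have hsimp : ∀ k : TorusSite 2 L, Real.sqrt ((torusBand L k - μ) ^ 2 + (2 * Real.sqrt 2 * 0 * dWaveGap k) ^ 2) =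
      |torusBand L k - μ| := fun k => by
    rw [mul_zero, zero_mul, zero_pow two_ne_zero, add_zero, Real.sqrt_sq_eq_abs]
  simp_rw [hsimp] at hZ
  rw [hZ, card_orb_fermionTorus_two]
  have hpow : (0 : ℝ) < (2 : ℝ) ^ (2 * L ^ 2) := by positivity
  have hfac : ∀ k : TorusSite 2 L, Real.exp (-(β * (torusBand L k - μ))) *
      ((1 + Real.cosh (β * |torusBand L k - μ|)) / 2) ≠ 0 := fun k => by
    have := Real.one_le_cosh (β * |torusBand L k - μ|); positivity
  rw [Real.log_mul hpow.ne' (Finset.prod_ne_zero_iff.2 fun k _ => hfac k),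
    Real.log_prod (s := Finset.univ) (hf := fun k _ => hfac k), Real.log_pow]
  set c := Real.log (1 + Real.exp (-(β * a))) with hc
  -- per mode: keep the mode's own entropy, then compare with the level indicator
  have hmode : ∀ k : TorusSite 2 L,
      (-(β * (torusBand L k - μ)) + β * |torusBand L k - μ|) +
        2 * c * (if |torusBand L k - μ| ≤ a then 1 else 0) - Real.log 4 ≤
      Real.log (Real.exp (-(β * (torusBand L k - μ))) * ((1 + Real.cosh (β * |torusBand L k - μ|)) / 2)) := by
    intro k
    have h1 := log_freeModeFactor_ge (ξ := torusBand L k - μ) hβ le_rfl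
    have h2 : 2 * c * (if |torusBand L k - μ| ≤ a then 1 else 0) ≤
        2 * Real.log (1 + Real.exp (-(β * |torusBand L k - μ|))) := by
      split_ifs with h
      · rw [mul_one]
        refine mul_le_mul_of_nonneg_left (Real.log_le_log (by positivity) ?_) (by norm_num)
        apply add_le_add le_rfl
        exact Real.exp_le_exp.2 (by nlinarith)
      · rw [mul_zero]
        have : 0 ≤ Real.log (1 + Real.exp (-(β * |torusBand L k - μ|))) :=
          Real.log_nonneg (by linarith [Real.exp_pos (-(β * |torusBand L k - μ|))])
        linarith
    linarith
  have hlo := Finset.sum_le_sum fun k (_ : k ∈ Finset.univ) => hmode k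
  have hid : ∀ k : TorusSite 2 L, -(β * (torusBand L k - μ)) + β * |torusBand L k - μ| =
      -2 * β * min (torusBand L k - μ) 0 := fun k => by
    have := neg_add_abs_eq (torusBand L k - μ)
    linear_combination β * this
  simp_rw [hid] at hlo
  rw [Finset.sum_sub_distrib, Finset.sum_add_distrib, Finset.sum_const, Finset.card_univ,
    card_torusSite_two, nsmul_eq_mul, ← Finset.mul_sum, ← Finset.mul_sum, Finset.sum_boole] at hlo
  have hlog4 : Real.log 4 = 2 * Real.log 2 := by
    rw [show (4 : ℝ) = 2 ^ 2 by norm_num, Real.log_pow]; push_cast; ring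
  have hcast : ((L ^ 2 : ℕ) : ℝ) = (L : ℝ) ^ 2 := by push_cast; ring
  have hcast2 : ((2 * L ^ 2 : ℕ) : ℝ) = 2 * (L : ℝ) ^ 2 := by push_cast; ring
  rw [hcast] at hlo
  rw [hcast2]
  rw [hlog4] at hlo
  linarith

/-- The same through the free ground energy: `−βE₀(K⁰_μ) + 2 log(1 + e^{−βa})·#{k : |ε_L(k) − μ| ≤ a} ≤ log Re Z_β(K⁰_μ)`. -/
theorem log_partitionFn_free_torus_ge_groundEnergy_level (L : ℕ) [NeZero L] (hL : 3 ≤ L) {β : ℝ} (hβ : 0 ≤ β)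
    (μ a : ℝ) :
    -(β * (hubbardTorusWith 2 L 1 0 μ).groundEnergy) +
        2 * Real.log (1 + Real.exp (-(β * a))) *
          ((Finset.univ.filter fun k : TorusSite 2 L => |torusBand L k - μ| ≤ a).card : ℝ) ≤
      Real.log (partitionFn β (hubbardTorusWith 2 L 1 0 μ)).re := by
  have h := log_partitionFn_free_torus_ge_level L hL hβ μ a
  rw [groundEnergy_hubbardTorusWith_zero hL μ]
  linarith

/-- **Pressure floor for the seeded model, level form.** For `L ≥ 3`, `U ≥ 0`, `g ≥ 0`, `β ≥ 0`, every `μ`, `a`: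
`log Re Z_β(Hgc(U,μ,g)) ≥ −β E₀(K⁰_μ) + 2 log(1 + e^{−βa})·#{k : |ε_L(k) − μ| ≤ a} − βUL²`. [folklore] -/
theorem log_partitionFn_seededGC_ge_level (L : ℕ) [NeZero L] (hL : 3 ≤ L) {U g β : ℝ} (hU : 0 ≤ U)
    (hg : 0 ≤ g) (hβ : 0 ≤ β) (μ a : ℝ) :
    -(β * (hubbardTorusWith 2 L 1 0 μ).groundEnergy) +
        2 * Real.log (1 + Real.exp (-(β * a))) *
          ((Finset.univ.filter fun k : TorusSite 2 L => |torusBand L k - μ| ≤ a).card : ℝ) -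
        β * U * (L : ℝ) ^ 2 ≤
      Real.log (partitionFn β (hubbardTorusWith 2 L 1 U μ - ((g / (L : ℝ) ^ 2 : ℝ) : ℂ) •
        ((pairField dWaveFormFactor L)ᴴ * pairField dWaveFormFactor L))).re := by
  have hLpos : (0 : ℝ) < (L : ℝ) ^ 2 := cast_sq_pos_of_neZero L
  -- (a) drop the seed
  have hseed : Real.log (partitionFn β (hubbardTorusWith 2 L 1 U μ)).re ≤
      Real.log (partitionFn β (hubbardTorusWith 2 L 1 U μ - ((g / (L : ℝ) ^ 2 : ℝ) : ℂ) •
        ((pairField dWaveFormFactor L)ᴴ * pairField dWaveFormFactor L))).re := by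
    refine log_partitionFn_le_of_posSemidef (isHermitian_seededGC L U μ g) (isHermitian_hubbardTorusWith L 1 U μ)
      hβ ?_
    rw [sub_sub_cancel]
    exact (pairField_conjTranspose_mul_self_posSemidef dWaveFormFactor L).smul
      (Complex.zero_le_real.2 (div_nonneg hg hLpos.le))
  -- (b) bound the repulsion by `U L²`
  have hW : hubbardTorusWith 2 L 1 U μ =
      hubbardTorusWith 2 L 1 0 μ + (U : ℂ) • ∑ x : FermionTorus 2 L, numberOp x 0 * numberOp x 1 := by
    have h := hamiltonianWith_sub_hamiltonianWith (fermionTorusGraph 2 L) 1 0 U μ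
    rw [sub_zero] at h
    change hubbardTorusWith 2 L 1 U μ - hubbardTorusWith 2 L 1 0 μ = _ at h
    rw [← h]; abel
  have hWnorm : ‖(U : ℂ) • ∑ x : FermionTorus 2 L,
      (numberOp x 0 * numberOp x 1 : Matrix (Finset (Orb (FermionTorus 2 L))) (Finset (Orb (FermionTorus 2 L))) ℂ)‖ ≤
      U * (L : ℝ) ^ 2 := by
    rw [norm_smul, Complex.norm_real, Real.norm_of_nonneg hU]
    refine mul_le_mul_of_nonneg_left ?_ hU
    calc ‖∑ x : FermionTorus 2 L,
          (numberOp x 0 * numberOp x 1 : Matrix (Finset (Orb (FermionTorus 2 L))) (Finset (Orb (FermionTorus 2 L))) ℂ)‖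
        ≤ ∑ x : FermionTorus 2 L,
          ‖(numberOp x 0 * numberOp x 1 : Matrix (Finset (Orb (FermionTorus 2 L))) (Finset (Orb (FermionTorus 2 L))) ℂ)‖ :=
          norm_sum_le _ _
      _ ≤ ∑ _x : FermionTorus 2 L, (1 : ℝ) := Finset.sum_le_sum fun x _ =>
          (norm_mul_le _ _).trans (mul_le_one₀ (norm_numberOp_le_one x 0) (norm_nonneg _) (norm_numberOp_le_one x 1))
      _ = (L : ℝ) ^ 2 := by
          rw [Finset.sum_const, Finset.card_univ, card_fermionTorus, nsmul_eq_mul, mul_one]; push_cast; ring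
  have hrep : Real.log (partitionFn β (hubbardTorusWith 2 L 1 0 μ)).re -
      Real.log (partitionFn β (hubbardTorusWith 2 L 1 U μ)).re ≤ β * (U * (L : ℝ) ^ 2) := by
    refine (log_partitionFn_sub_log_partitionFn_le (isHermitian_hubbardTorusWith L 1 0 μ)
      (isHermitian_hubbardTorusWith L 1 U μ) hβ).trans ?_
    rw [hW, add_sub_cancel_left]
    exact mul_le_mul_of_nonneg_left hWnorm hβ
  -- (c) the free level floor
  have hfree := log_partitionFn_free_torus_ge_groundEnergy_level L hL hβ μ a
  nlinarith [hfree, hrep, hseed]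

/-- **TEMPLATE H′ — THE LEVEL FLOOR.** For `L ≥ 3`, `U, g ≥ 0`, `β > 0`, every `μ`, `a` and every sector `K ≠ ⊥` of
`N`-particle vectors: `(2/β) log(1 + e^{−βa})·#{k : |ε_L(k) − μ| ≤ a}/L² − U − 32g ≤ minE(Hcan,K)/L² + log Re Z/(βL²) − μN/L²`. -/
theorem seeded_defect_floor_level (L : ℕ) [NeZero L] (hL : 3 ≤ L) {U g β : ℝ} (hU : 0 ≤ U) (hg : 0 ≤ g)
    (hβ : 0 < β) (μ a : ℝ) {N : ℕ} (K : Submodule ℂ (Fock (Orb (FermionTorus 2 L)))) (hK : K ≠ ⊥)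
    (hKN : ∀ ψ ∈ K, IsNParticle N ψ) :
    2 / β * Real.log (1 + Real.exp (-(β * a))) *
          ((Finset.univ.filter fun k : TorusSite 2 L => |torusBand L k - μ| ≤ a).card : ℝ) / (L : ℝ) ^ 2 - U - 32 * g ≤
      (hubbardTorus 2 L 1 U - ((g / (L : ℝ) ^ 2 : ℝ) : ℂ) •
          ((pairField dWaveFormFactor L)ᴴ * pairField dWaveFormFactor L)).minEnergyOn K / (L : ℝ) ^ 2 +
        Real.log (partitionFn β (hubbardTorusWith 2 L 1 U μ - ((g / (L : ℝ) ^ 2 : ℝ) : ℂ) •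
          ((pairField dWaveFormFactor L)ᴴ * pairField dWaveFormFactor L))).re / (β * (L : ℝ) ^ 2) -
        μ * N / (L : ℝ) ^ 2 := by
  have hLpos : (0 : ℝ) < (L : ℝ) ^ 2 := cast_sq_pos_of_neZero L
  have hβL : 0 < β * (L : ℝ) ^ 2 := mul_pos hβ hLpos
  -- T = 0 chain: minE − μN ≥ E₀(Hgc U g) ≥ E₀(Hgc 0 g) ≥ E₀(K⁰_μ) − 32 g L²
  have h1 := groundEnergy_seededGC_add_le_minEnergyOn L U μ g K hK hKN
  have h2 := groundEnergy_seededGC_mono_U L hU μ g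
  have h3 := groundEnergy_seededGC_le_add L 0 μ (g₀ := 0) hg
  have h30 : hubbardTorusWith 2 L 1 0 μ - ((0 / (L : ℝ) ^ 2 : ℝ) : ℂ) •
      ((pairField dWaveFormFactor L)ᴴ * pairField dWaveFormFactor L) = hubbardTorusWith 2 L 1 0 μ := by
    rw [zero_div, Complex.ofReal_zero, zero_smul, sub_zero]
  rw [h30, sub_zero] at h3
  -- thermal chain
  have h4 := log_partitionFn_seededGC_ge_level L hL hU hg hβ.le μ a
  set A := (hubbardTorus 2 L 1 U - ((g / (L : ℝ) ^ 2 : ℝ) : ℂ) •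
    ((pairField dWaveFormFactor L)ᴴ * pairField dWaveFormFactor L)).minEnergyOn K
  set Z := Real.log (partitionFn β (hubbardTorusWith 2 L 1 U μ - ((g / (L : ℝ) ^ 2 : ℝ) : ℂ) •
    ((pairField dWaveFormFactor L)ᴴ * pairField dWaveFormFactor L))).re
  set E := (hubbardTorusWith 2 L 1 0 μ).groundEnergy
  set M := 2 * Real.log (1 + Real.exp (-(β * a))) *
    ((Finset.univ.filter fun k : TorusSite 2 L => |torusBand L k - μ| ≤ a).card : ℝ)
  have hA : E - 32 * g * (L : ℝ) ^ 2 ≤ A - μ * N := by linarith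
  have hZ : -(β * E) + M - β * U * (L : ℝ) ^ 2 ≤ Z := h4
  have hZ' : -(E / (L : ℝ) ^ 2) + M / (β * (L : ℝ) ^ 2) - U ≤ Z / (β * (L : ℝ) ^ 2) := by
    rw [le_div_iff₀ hβL]
    have : (-(E / (L : ℝ) ^ 2) + M / (β * (L : ℝ) ^ 2) - U) * (β * (L : ℝ) ^ 2) =
        -(β * E) + M - β * U * (L : ℝ) ^ 2 := by
      field_simp
    linarith
  have hA' : (E - 32 * g * (L : ℝ) ^ 2) / (L : ℝ) ^ 2 ≤ (A - μ * N) / (L : ℝ) ^ 2 :=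
    div_le_div_of_nonneg_right hA hLpos.le
  have e1 : (E - 32 * g * (L : ℝ) ^ 2) / (L : ℝ) ^ 2 = E / (L : ℝ) ^ 2 - 32 * g := by
    rw [sub_div, mul_div_assoc, div_self hLpos.ne', mul_one]
  have e2 : (A - μ * N) / (L : ℝ) ^ 2 = A / (L : ℝ) ^ 2 - μ * N / (L : ℝ) ^ 2 := by rw [sub_div]
  have e3 : M / (β * (L : ℝ) ^ 2) = 2 / β * Real.log (1 + Real.exp (-(β * a))) *
      ((Finset.univ.filter fun k : TorusSite 2 L => |torusBand L k - μ| ≤ a).card : ℝ) / (L : ℝ) ^ 2 := by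
    simp only [M]
    field_simp
  rw [e1, e2] at hA'
  rw [e3] at hZ'
  linarith

/-- **The polynomial floor at the crux's sector.** For `L ≥ 3` with `16πβ ≤ L`, `U, g ≥ 0`, `β ≥ 1`, `|μ| ≤ 4`, `0 ≤ δ`:
`(2/β) log(1 + e^{−1}) (16πβ)⁻² − U − 32g ≤ D_L(β,μ;U,g)` (level window `a = 1/β`). [folklore] -/
theorem seeded_defect_floor_cube (L : ℕ) [NeZero L] (hL : 3 ≤ L) {U g β μ δ : ℝ} (hU : 0 ≤ U) (hg : 0 ≤ g)
    (hβ : 1 ≤ β) (hμ : |μ| ≤ 4) (hδ : 0 ≤ δ) (hLβ : 16 * Real.pi * β ≤ L) :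
    2 / β * Real.log (1 + Real.exp (-1)) * (1 / (16 * Real.pi * β)) ^ 2 - U - 32 * g ≤
      (hubbardTorus 2 L 1 U - ((g / (L : ℝ) ^ 2 : ℝ) : ℂ) •
          ((pairField dWaveFormFactor L)ᴴ * pairField dWaveFormFactor L)).minEnergyOn
          (szSector (Λ := FermionTorus 2 L) (2 * ⌊(1 - δ) * (L : ℝ) ^ 2 / 2⌋₊) 0) / (L : ℝ) ^ 2 +
        Real.log (partitionFn β (hubbardTorusWith 2 L 1 U μ - ((g / (L : ℝ) ^ 2 : ℝ) : ℂ) •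
          ((pairField dWaveFormFactor L)ᴴ * pairField dWaveFormFactor L))).re / (β * (L : ℝ) ^ 2) -
        μ * (2 * (⌊(1 - δ) * (L : ℝ) ^ 2 / 2⌋₊ : ℝ)) / (L : ℝ) ^ 2 := by
  have hπ := Real.pi_pos
  have hβpos : 0 < β := lt_of_lt_of_le one_pos hβ
  have hLpos : (0 : ℝ) < (L : ℝ) ^ 2 := cast_sq_pos_of_neZero L
  have hLr : (0 : ℝ) < L := by
    have : 0 < L := Nat.pos_of_ne_zero (NeZero.ne L)
    exact_mod_cast this
  have h := seeded_defect_floor_level L hL hU hg hβpos μ (1 / β) (N := 2 * ⌊(1 - δ) * (L : ℝ) ^ 2 / 2⌋₊)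
    (szSector (Λ := FermionTorus 2 L) (2 * ⌊(1 - δ) * (L : ℝ) ^ 2 / 2⌋₊) 0) (szSector_floor_ne_bot L hδ)
    (fun ψ hψ => ((mem_szSector_iff _ _ ψ).1 hψ).1)
  have hcast : ((2 * ⌊(1 - δ) * (L : ℝ) ^ 2 / 2⌋₊ : ℕ) : ℝ) = 2 * (⌊(1 - δ) * (L : ℝ) ^ 2 / 2⌋₊ : ℝ) := by
    push_cast; ring
  rw [hcast] at h
  -- the count with a = 1/β
  have ha2 : 1 / β ≤ 2 := by rw [div_le_iff₀ hβpos]; linarith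
  have hcond : 1 ≤ 1 / β * L / (16 * Real.pi) := by
    rw [le_div_iff₀ (by positivity), one_div_mul_eq_div, le_div_iff₀ hβpos]
    linarith
  have hcnt := sq_le_card_filter_abs_torusBand_sub_le (L := L) (ν := μ) hμ (one_div_pos.2 hβpos) ha2 hcond
  have hβa : Real.exp (-(β * (1 / β))) = Real.exp (-1) := by rw [mul_one_div_cancel hβpos.ne']
  rw [hβa] at h
  have hc0 : 0 ≤ 2 / β * Real.log (1 + Real.exp (-1)) := by
    have : 0 ≤ Real.log (1 + Real.exp (-1)) := Real.log_nonneg (by linarith [Real.exp_pos (-1 : ℝ)])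
    positivity
  have hkey : 2 / β * Real.log (1 + Real.exp (-1)) * (1 / (16 * Real.pi * β)) ^ 2 ≤
      2 / β * Real.log (1 + Real.exp (-1)) *
        ((Finset.univ.filter fun k : TorusSite 2 L => |torusBand L k - μ| ≤ 1 / β).card : ℝ) / (L : ℝ) ^ 2 := by
    rw [mul_div_assoc]
    refine mul_le_mul_of_nonneg_left ?_ hc0
    rw [le_div_iff₀ hLpos]
    have e : (1 / (16 * Real.pi * β)) ^ 2 * (L : ℝ) ^ 2 = (1 / β * L / (16 * Real.pi)) ^ 2 := by
      field_simp
    rw [e]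
    exact hcnt
  linarith

/-! ### Kill forms -/

/-- **Any allowance below the polynomial floor at one temperature is refuted (repaired crux shape).** If
`A(β₀) < (2/β₀) log(1 + e^{−1}) (16πβ₀)⁻²` at some `β₀ ≥ 1`, the variant of `TwSeededEnsembleEquivalenceR` with
allowance `A(β)` in place of `log 4/β` is FALSE (witness: `δ = 1/10`, `β = β₀`, `U → 0⁺` with `β₀ ≤ e^{a/U}`, `g = K'U`,
`L ≥ max(L₀, 3, 16πβ₀)`). [folklore] -/
theorem twSeededEnsembleEquivalenceR_false_of_allowance_lt_cube (A : ℝ → ℝ) {β₀ : ℝ} (hβ₀ : 1 ≤ β₀)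
    (hA : A β₀ < 2 / β₀ * Real.log (1 + Real.exp (-1)) * (1 / (16 * Real.pi * β₀)) ^ 2) :
    ¬ (∀ δ ∈ Set.Icc (1/10 : ℝ) (2/5 : ℝ), ∃ μ₁ μ₂ : ℝ, -4 < μ₁ ∧ μ₁ ≤ μ₂ ∧ μ₂ < 0 ∧
        ∃ a K' U₀ : ℝ, 0 < a ∧ 0 < K' ∧ 0 < U₀ ∧ ∀ U ∈ Set.Ioc (0 : ℝ) U₀, ∀ g ∈ Set.Icc (K' * U) (1 / 10),
          ∀ β : ℝ, 1 ≤ β → β ≤ Real.exp (a / U) →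
            ∃ μ ∈ Set.Icc μ₁ μ₂, ∀ ε : ℝ, 0 < ε → ∃ L₀ : ℕ, ∀ (L : ℕ) [NeZero L], L₀ ≤ L →
              (((hubbardTorus 2 L 1 U - ((g / (L : ℝ) ^ 2 : ℝ) : ℂ) •
                ((pairField dWaveFormFactor L)ᴴ * pairField dWaveFormFactor L))).minEnergyOn
                  (szSector (Λ := FermionTorus 2 L) (2 * ⌊(1 - δ) * (L : ℝ) ^ 2 / 2⌋₊) 0) / (L : ℝ) ^ 2) +
                (Real.log (Matrix.partitionFn β (hubbardTorusWith 2 L 1 U μ - ((g / (L : ℝ) ^ 2 : ℝ) : ℂ) •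
                  ((pairField dWaveFormFactor L)ᴴ * pairField dWaveFormFactor L))).re / (β * (L : ℝ) ^ 2)) -
                μ * ((2 * ⌊(1 - δ) * (L : ℝ) ^ 2 / 2⌋₊) : ℝ) / (L : ℝ) ^ 2 ≤ A β + ε) := by
  intro H
  have hπ := Real.pi_pos
  set c := 2 / β₀ * Real.log (1 + Real.exp (-1)) * (1 / (16 * Real.pi * β₀)) ^ 2 - A β₀ with hc
  have hcpos : 0 < c := by rw [hc]; linarith
  have hδ : (1/10 : ℝ) ∈ Set.Icc (1/10 : ℝ) (2/5 : ℝ) := ⟨le_rfl, by norm_num⟩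
  obtain ⟨μ₁, μ₂, hμ₁, hμ₁₂, hμ₂, a, K', U₀, ha, hK', hU₀, hU⟩ := H (1/10) hδ
  have hlog : 0 ≤ Real.log β₀ := Real.log_nonneg hβ₀
  have hlog1 : 0 < Real.log β₀ + 1 := by linarith
  set U : ℝ := min U₀ (min (c / 4) (min (c / (128 * K')) (min (1 / (10 * K')) (a / (Real.log β₀ + 1)))))
    with hUdef
  have hUpos : 0 < U := by
    rw [hUdef]
    refine lt_min hU₀ (lt_min (by positivity) (lt_min (by positivity) (lt_min (by positivity) (by positivity))))
  have hUU₀ : U ≤ U₀ := min_le_left _ _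
  have hUc : U ≤ c / 4 := (min_le_right _ _).trans (min_le_left _ _)
  have hUcK : U ≤ c / (128 * K') := (min_le_right _ _).trans ((min_le_right _ _).trans (min_le_left _ _))
  have hUK : U ≤ 1 / (10 * K') :=
    (min_le_right _ _).trans ((min_le_right _ _).trans ((min_le_right _ _).trans (min_le_left _ _)))
  have hUa : U ≤ a / (Real.log β₀ + 1) :=
    (min_le_right _ _).trans ((min_le_right _ _).trans ((min_le_right _ _).trans (min_le_right _ _)))
  have hUm : U ∈ Set.Ioc (0 : ℝ) U₀ := ⟨hUpos, hUU₀⟩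
  have hg32 : 32 * (K' * U) ≤ c / 4 := by
    have h := mul_le_mul_of_nonneg_left hUcK hK'.le
    have e : K' * (c / (128 * K')) = c / 128 := by field_simp
    rw [e] at h
    linarith
  have hgm : K' * U ∈ Set.Icc (K' * U) (1 / 10) := by
    refine ⟨le_rfl, ?_⟩
    have h := mul_le_mul_of_nonneg_left hUK hK'.le
    have e : K' * (1 / (10 * K')) = 1 / 10 := by field_simp
    linarith [h, e.le, e.ge]
  have hβexp : β₀ ≤ Real.exp (a / U) := by
    have h1 : Real.log β₀ ≤ a / U := by
      rw [le_div_iff₀ hUpos]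
      have h2 : U * (Real.log β₀ + 1) ≤ a := by
        have := mul_le_mul_of_nonneg_right hUa hlog1.le
        rwa [div_mul_cancel₀ _ hlog1.ne'] at this
      nlinarith
    calc β₀ = Real.exp (Real.log β₀) := (Real.exp_log (lt_of_lt_of_le one_pos hβ₀)).symm
      _ ≤ Real.exp (a / U) := Real.exp_le_exp.2 h1
  obtain ⟨μ, hμm, hμ⟩ := hU U hUm (K' * U) hgm β₀ hβ₀ hβexp
  obtain ⟨L₀, hL₀⟩ := hμ (c / 4) (by positivity)
  obtain ⟨L₁, hL₁⟩ := exists_nat_gt (16 * Real.pi * β₀)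
  set L : ℕ := max L₀ (max 3 L₁) with hLdef
  haveI : NeZero L := ⟨by omega⟩
  have hL3 : 3 ≤ L := (le_max_left _ _).trans (le_max_right _ _)
  have hL1 : (L₁ : ℝ) ≤ L := by
    have : L₁ ≤ L := (le_max_right _ _).trans (le_max_right _ _)
    exact_mod_cast this
  have hinst := hL₀ L (le_max_left _ _)
  have hμabs : |μ| ≤ 4 := by
    rw [abs_le]; constructor <;> linarith [hμm.1, hμm.2]
  have hfloor := seeded_defect_floor_cube L hL3 (U := U) (g := K' * U) (δ := 1/10) hUpos.le
    (mul_nonneg hK'.le hUpos.le) hβ₀ hμabs (by norm_num) (by linarith)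
  change _ ≤ A β₀ + c / 4 at hinst
  linarith

/-- `1 + e^{−1} > 1`, so the floor constant is positive. -/
theorem log_one_add_exp_neg_one_pos : 0 < Real.log (1 + Real.exp (-1)) :=
  Real.log_pos (by linarith [Real.exp_pos (-1 : ℝ)])

/-- **No `O(β⁻⁴)` allowance**: for every constant `C`, `TwSeededEnsembleEquivalenceR` with `log 4/β` replaced by `C/β⁴`
is FALSE (take `β₀ > max(1, 256π² C/(2 log(1+e^{−1})))`). The allowance is load-bearing at every temperature scale of
the window `[1, e^{a/U}]`, polynomially — not only near `β = 1`. -/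
theorem twSeededEnsembleEquivalenceR_false_of_allowance_inv_pow_four (C : ℝ) :
    ¬ (∀ δ ∈ Set.Icc (1/10 : ℝ) (2/5 : ℝ), ∃ μ₁ μ₂ : ℝ, -4 < μ₁ ∧ μ₁ ≤ μ₂ ∧ μ₂ < 0 ∧
        ∃ a K' U₀ : ℝ, 0 < a ∧ 0 < K' ∧ 0 < U₀ ∧ ∀ U ∈ Set.Ioc (0 : ℝ) U₀, ∀ g ∈ Set.Icc (K' * U) (1 / 10),
          ∀ β : ℝ, 1 ≤ β → β ≤ Real.exp (a / U) →
            ∃ μ ∈ Set.Icc μ₁ μ₂, ∀ ε : ℝ, 0 < ε → ∃ L₀ : ℕ, ∀ (L : ℕ) [NeZero L], L₀ ≤ L →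
              (((hubbardTorus 2 L 1 U - ((g / (L : ℝ) ^ 2 : ℝ) : ℂ) •
                ((pairField dWaveFormFactor L)ᴴ * pairField dWaveFormFactor L))).minEnergyOn
                  (szSector (Λ := FermionTorus 2 L) (2 * ⌊(1 - δ) * (L : ℝ) ^ 2 / 2⌋₊) 0) / (L : ℝ) ^ 2) +
                (Real.log (Matrix.partitionFn β (hubbardTorusWith 2 L 1 U μ - ((g / (L : ℝ) ^ 2 : ℝ) : ℂ) •
                  ((pairField dWaveFormFactor L)ᴴ * pairField dWaveFormFactor L))).re / (β * (L : ℝ) ^ 2)) -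
                μ * ((2 * ⌊(1 - δ) * (L : ℝ) ^ 2 / 2⌋₊) : ℝ) / (L : ℝ) ^ 2 ≤ C / β ^ 4 + ε) := by
  have hπ := Real.pi_pos
  set ℓ := Real.log (1 + Real.exp (-1)) with hℓ
  have hℓpos : 0 < ℓ := log_one_add_exp_neg_one_pos
  -- β₀ := max 1 (256 π² C/(2ℓ) + 1)
  set β₀ : ℝ := max 1 (256 * Real.pi ^ 2 * C / (2 * ℓ) + 1) with hβ₀
  have hβ₀1 : 1 ≤ β₀ := le_max_left _ _
  have hβ₀pos : 0 < β₀ := lt_of_lt_of_le one_pos hβ₀1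
  refine twSeededEnsembleEquivalenceR_false_of_allowance_lt_cube (fun β => C / β ^ 4) hβ₀1 ?_
  show C / β₀ ^ 4 < 2 / β₀ * ℓ * (1 / (16 * Real.pi * β₀)) ^ 2
  have e : 2 / β₀ * ℓ * (1 / (16 * Real.pi * β₀)) ^ 2 = (2 * ℓ / (256 * Real.pi ^ 2)) / β₀ ^ 3 := by
    field_simp; ring
  rw [e, div_lt_div_iff₀ (by positivity) (by positivity)]
  have hC : C < 2 * ℓ / (256 * Real.pi ^ 2) * β₀ := by
    have h1 : 256 * Real.pi ^ 2 * C / (2 * ℓ) + 1 ≤ β₀ := le_max_right _ _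
    have h2 : 256 * Real.pi ^ 2 * C / (2 * ℓ) < β₀ := by linarith
    rw [div_lt_iff₀ (by positivity)] at h2
    rw [div_mul_eq_mul_div, lt_div_iff₀ (by positivity)]
    linarith
  have hβ3 : 0 < β₀ ^ 3 := by positivity
  calc C * β₀ ^ 3 < 2 * ℓ / (256 * Real.pi ^ 2) * β₀ * β₀ ^ 3 := by nlinarith
    _ = 2 * ℓ / (256 * Real.pi ^ 2) * β₀ ^ 4 := by ring


/-! ### (inlined) EmptyBand.lean — Template I′, the body is false at `δ = 1` by a COLD kill -/

/-! ### The vacuum sector carries zero seeded energy -/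

/-- A `0`-particle vector is its vacuum component times the vacuum. [folklore] -/
theorem eq_smul_vacuum_of_isNParticle_zero {ι : Type*} [LinearOrder ι] {ψ : Fock ι} (h : IsNParticle 0 ψ) :
    ψ = ψ ∅ • (vacuum : Fock ι) := by
  funext s
  by_cases hs : s = ∅
  · subst hs
    rw [Pi.smul_apply, vacuum, Pi.single_eq_same, smul_eq_mul, mul_one]
  · have : ψ s = 0 := h s (fun hc => hs (Finset.card_eq_zero.mp hc))
    rw [Pi.smul_apply, vacuum, Pi.single_eq_of_ne hs, smul_zero]
    exact this

/-- The local pair operator annihilates the vacuum. [folklore] -/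
theorem localPair_mulVec_vacuum_eq_zero (L : ℕ) [NeZero L] (x : TorusSite 2 L) :
    localPair dWaveFormFactor L x *ᵥ (vacuum : Fock (Orb (FermionTorus 2 L))) = 0 := by
  have han : ∀ (A : Matrix (Finset (Orb (FermionTorus 2 L))) (Finset (Orb (FermionTorus 2 L))) ℂ)
      (i : Orb (FermionTorus 2 L)), (A * annihilation i) *ᵥ (vacuum : Fock (Orb (FermionTorus 2 L))) = 0 :=
    fun A i => by rw [← mulVec_mulVec, annihilation_mulVec_vacuum_holds, mulVec_zero]
  simp only [localPair, Matrix.sum_mulVec, Matrix.smul_mulVec, Matrix.sub_mulVec, han, sub_zero, smul_zero,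
    Finset.sum_const_zero]

/-- The pair field annihilates the vacuum. [folklore] -/
theorem pairField_mulVec_vacuum_eq_zero (L : ℕ) [NeZero L] :
    pairField dWaveFormFactor L *ᵥ (vacuum : Fock (Orb (FermionTorus 2 L))) = 0 := by
  rw [pairField, Matrix.sum_mulVec]
  exact Finset.sum_eq_zero fun x _ => localPair_mulVec_vacuum_eq_zero L x

/-- The seeded canonical Hamiltonian annihilates the vacuum. [folklore] -/
theorem seededCan_mulVec_vacuum (L : ℕ) [NeZero L] (U g : ℝ) :
    (hubbardTorus 2 L 1 U - ((g / (L : ℝ) ^ 2 : ℝ) : ℂ) •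
        ((pairField dWaveFormFactor L)ᴴ * pairField dWaveFormFactor L)) *ᵥ
      (vacuum : Fock (Orb (FermionTorus 2 L))) = 0 := by
  rw [sub_mulVec, smul_mulVec, ← mulVec_mulVec, pairField_mulVec_vacuum_eq_zero, mulVec_zero, smul_zero,
    sub_zero]
  exact hamiltonian_mulVec_vacuum (fermionTorusGraph 2 L) 1 U

/-- **Zero-particle sectors carry zero seeded energy**: `0 ≤ minE(Hcan(U,g), K)` for every `K ≠ ⊥` of `0`-particle
vectors (in fact `= 0`). [folklore] -/
theorem minEnergyOn_seededCan_vacuumSector_nonneg (L : ℕ) [NeZero L] (U g : ℝ)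
    (K : Submodule ℂ (Fock (Orb (FermionTorus 2 L)))) (hK : K ≠ ⊥) (hKN : ∀ ψ ∈ K, IsNParticle 0 ψ) :
    0 ≤ (hubbardTorus 2 L 1 U - ((g / (L : ℝ) ^ 2 : ℝ) : ℂ) •
        ((pairField dWaveFormFactor L)ᴴ * pairField dWaveFormFactor L)).minEnergyOn K := by
  obtain ⟨v, hvK, hv0⟩ := (Submodule.ne_bot_iff K).1 hK
  obtain ⟨c, -, hc1⟩ := exists_smul_unit hv0
  refine le_csInf ⟨_, c • v, K.smul_mem c hvK, hc1, rfl⟩ ?_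
  rintro E ⟨φ, hφK, hφ1, rfl⟩
  rw [eq_smul_vacuum_of_isNParticle_zero (hKN φ hφK), mulVec_smul, seededCan_mulVec_vacuum, smul_zero,
    dotProduct_zero, Complex.zero_re]

/-! ### The free filling energy at the band bottom -/

/-- **Filling energy near the band bottom.** For `L ≥ 3`, `μ = −4 + m` with `0 ≤ a ≤ m/2`:
`m·#{k : |ε_L(k) + 4| ≤ a} ≤ −E₀(K⁰_μ)` (each such level lies `≥ m − a ≥ m/2` below `μ` and is filled twice). [folklore] -/
theorem mul_card_le_neg_groundEnergy_free (L : ℕ) [NeZero L] (hL : 3 ≤ L) {m a μ : ℝ} (hμ : μ = -4 + m)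
    (ham : a ≤ m / 2) :
    m * ((Finset.univ.filter fun k : TorusSite 2 L => |torusBand L k - (-4)| ≤ a).card : ℝ) ≤
      -(hubbardTorusWith 2 L 1 0 μ).groundEnergy := by
  classical
  rw [groundEnergy_hubbardTorusWith_zero hL μ]
  have hpt : ∀ k : TorusSite 2 L, min (torusBand L k - μ) 0 ≤
      -(m / 2) * (if |torusBand L k - (-4)| ≤ a then 1 else 0) := by
    intro k
    split_ifs with h
    · rw [abs_le] at h
      have : torusBand L k - μ ≤ -(m / 2) := by rw [hμ]; linarith [h.2]
      rw [mul_one]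
      exact (min_le_left _ _).trans this
    · rw [mul_zero]; exact min_le_right _ _
  have hsum := Finset.sum_le_sum fun k (_ : k ∈ Finset.univ) => hpt k
  rw [← Finset.mul_sum, Finset.sum_boole] at hsum
  linarith

/-! ### Template I′ — the kill at the empty band -/

/-- **The body of the repaired crux at `δ = 1` (empty band) is FALSE.** Against any window `[μ₁,μ₂] ⊂ (−4,0)` and any
`(a, K', U₀)` the disprover plays `m := μ₁ + 4 > 0`, `w := min 2 (m/2)`, `κ₀ := m (w/(16π))²`, `β := max 1 (8 log 4/κ₀)`,
`U := min U₀ (min (κ₀/4) (min (1/(10K')) (a/(log β + 1))))` (so `β ≤ e^{a/U}`), `g := K'U`, `ε := κ₀/8`, `L ≥ 16π/w`: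
then `D_L = 0 + p_L ≥ −E₀(Hgc)/L² ≥ κ₀ − U ≥ 3κ₀/4 > log 4/β + ε`. [folklore] -/
theorem twSeededEnsembleEquivalenceR_body_false_at_emptyBand :
    ¬ (∃ μ₁ μ₂ : ℝ, -4 < μ₁ ∧ μ₁ ≤ μ₂ ∧ μ₂ < 0 ∧
        ∃ a K' U₀ : ℝ, 0 < a ∧ 0 < K' ∧ 0 < U₀ ∧ ∀ U ∈ Set.Ioc (0 : ℝ) U₀, ∀ g ∈ Set.Icc (K' * U) (1 / 10),
          ∀ β : ℝ, 1 ≤ β → β ≤ Real.exp (a / U) →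
            ∃ μ ∈ Set.Icc μ₁ μ₂, ∀ ε : ℝ, 0 < ε → ∃ L₀ : ℕ, ∀ (L : ℕ) [NeZero L], L₀ ≤ L →
              (((hubbardTorus 2 L 1 U - ((g / (L : ℝ) ^ 2 : ℝ) : ℂ) •
                ((pairField dWaveFormFactor L)ᴴ * pairField dWaveFormFactor L))).minEnergyOn
                  (szSector (Λ := FermionTorus 2 L) (2 * ⌊(1 - (1 : ℝ)) * (L : ℝ) ^ 2 / 2⌋₊) 0) / (L : ℝ) ^ 2) +
                (Real.log (Matrix.partitionFn β (hubbardTorusWith 2 L 1 U μ - ((g / (L : ℝ) ^ 2 : ℝ) : ℂ) •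
                  ((pairField dWaveFormFactor L)ᴴ * pairField dWaveFormFactor L))).re / (β * (L : ℝ) ^ 2)) -
                μ * ((2 * ⌊(1 - (1 : ℝ)) * (L : ℝ) ^ 2 / 2⌋₊) : ℝ) / (L : ℝ) ^ 2 ≤ Real.log 4 / β + ε) := by
  rintro ⟨μ₁, μ₂, hμ₁, hμ₁₂, hμ₂, a, K', U₀, ha, hK', hU₀, H⟩
  have hπ := Real.pi_pos
  -- the margin
  set m : ℝ := μ₁ + 4 with hmdef
  have hm : 0 < m := by rw [hmdef]; linarith
  set w : ℝ := min 2 (m / 2) with hwdef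
  have hw0 : 0 < w := lt_min (by norm_num) (by positivity)
  have hw2 : w ≤ 2 := min_le_left _ _
  have hwm : w ≤ m / 2 := min_le_right _ _
  set κ₀ : ℝ := m * (w / (16 * Real.pi)) ^ 2 with hκ₀
  have hκ₀pos : 0 < κ₀ := by positivity
  -- the witness temperature
  set β : ℝ := max 1 (8 * Real.log 4 / κ₀) with hβdef
  have hβ1 : 1 ≤ β := le_max_left _ _
  have hβpos : 0 < β := lt_of_lt_of_le one_pos hβ1
  have hlog4 : 0 < Real.log 4 := Real.log_pos (by norm_num)
  have hslack : Real.log 4 / β ≤ κ₀ / 8 := by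
    rw [div_le_iff₀ hβpos]
    have : 8 * Real.log 4 / κ₀ ≤ β := le_max_right _ _
    rw [div_le_iff₀ hκ₀pos] at this
    linarith
  have hlog : 0 ≤ Real.log β := Real.log_nonneg hβ1
  have hlog1 : 0 < Real.log β + 1 := by linarith
  -- the witness coupling and seed
  set U : ℝ := min U₀ (min (κ₀ / 4) (min (1 / (10 * K')) (a / (Real.log β + 1)))) with hUdef
  have hUpos : 0 < U := by
    rw [hUdef]
    exact lt_min hU₀ (lt_min (by positivity) (lt_min (by positivity) (by positivity)))
  have hUU₀ : U ≤ U₀ := min_le_left _ _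
  have hUκ : U ≤ κ₀ / 4 := (min_le_right _ _).trans (min_le_left _ _)
  have hUK : U ≤ 1 / (10 * K') := (min_le_right _ _).trans ((min_le_right _ _).trans (min_le_left _ _))
  have hUa : U ≤ a / (Real.log β + 1) := (min_le_right _ _).trans ((min_le_right _ _).trans (min_le_right _ _))
  have hUm : U ∈ Set.Ioc (0 : ℝ) U₀ := ⟨hUpos, hUU₀⟩
  have hgm : K' * U ∈ Set.Icc (K' * U) (1 / 10) := by
    refine ⟨le_rfl, ?_⟩
    have h := mul_le_mul_of_nonneg_left hUK hK'.le
    have e : K' * (1 / (10 * K')) = 1 / 10 := by field_simp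
    linarith [h, e.le, e.ge]
  have hβexp : β ≤ Real.exp (a / U) := by
    have h1 : Real.log β ≤ a / U := by
      rw [le_div_iff₀ hUpos]
      have h2 : U * (Real.log β + 1) ≤ a := by
        have := mul_le_mul_of_nonneg_right hUa hlog1.le
        rwa [div_mul_cancel₀ _ hlog1.ne'] at this
      nlinarith
    calc β = Real.exp (Real.log β) := (Real.exp_log hβpos).symm
      _ ≤ Real.exp (a / U) := Real.exp_le_exp.2 h1
  obtain ⟨μ, hμm, hμ⟩ := H U hUm (K' * U) hgm β hβ1 hβexp
  obtain ⟨L₀, hL₀⟩ := hμ (κ₀ / 8) (by positivity)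
  -- a side `L ≥ max(L₀, 3, 16π/w)`
  obtain ⟨L₁, hL₁⟩ := exists_nat_gt (16 * Real.pi / w)
  set L : ℕ := max L₀ (max 3 L₁) with hLdef
  haveI : NeZero L := ⟨by omega⟩
  have hL3 : 3 ≤ L := (le_max_left _ _).trans (le_max_right _ _)
  have hL1 : (L₁ : ℝ) ≤ L := by
    have : L₁ ≤ L := (le_max_right _ _).trans (le_max_right _ _)
    exact_mod_cast this
  have hLpos : (0 : ℝ) < (L : ℝ) ^ 2 := cast_sq_pos_of_neZero L
  have hinst := hL₀ L (le_max_left _ _)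
  -- the sector at δ = 1 is the vacuum line
  have hN : 2 * ⌊(1 - (1 : ℝ)) * (L : ℝ) ^ 2 / 2⌋₊ = 0 := by simp
  have hNr : (2 : ℝ) * (⌊(1 - (1 : ℝ)) * (L : ℝ) ^ 2 / 2⌋₊ : ℝ) = 0 := by simp
  rw [hNr, mul_zero, zero_div, sub_zero] at hinst
  have hKne := szSector_floor_ne_bot L (δ := 1) zero_le_one
  have hKN : ∀ ψ ∈ szSector (Λ := FermionTorus 2 L) (2 * ⌊(1 - (1 : ℝ)) * (L : ℝ) ^ 2 / 2⌋₊) 0, IsNParticle 0 ψ :=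
    fun ψ hψ => by
      have h := ((mem_szSector_iff _ _ ψ).1 hψ).1
      rwa [hN] at h
  have hA := minEnergyOn_seededCan_vacuumSector_nonneg L U (K' * U) _ hKne hKN
  -- the pressure from the grand-canonical ground energy
  have hZ := neg_mul_groundEnergy_le_log_partitionFn (isHermitian_seededGC L U μ (K' * U)) β
  have hE1 := groundEnergy_seededGC_le_free_add L hUpos.le (mul_nonneg hK'.le hUpos.le) μ (g := K' * U)
  -- the free filling energy: μ = −4 + m' with m' = μ + 4 ≥ m, a := w ≤ m/2 ≤ m'/2
  have hm' : w ≤ (μ + 4) / 2 := by linarith [hμm.1]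
  have hE2 := mul_card_le_neg_groundEnergy_free L hL3 (m := μ + 4) (a := w) (μ := μ) (by ring) hm'
  have hLw : 1 ≤ w * L / (16 * Real.pi) := by
    rw [le_div_iff₀ (by positivity)]
    have h1 : 16 * Real.pi / w < L := hL₁.trans_le hL1
    rw [div_lt_iff₀ hw0] at h1
    linarith
  have hcnt := sq_le_card_filter_abs_torusBand_sub_le (L := L) (ν := -4) (by norm_num) hw0 hw2 hLw
  -- assemble: −E₀(Hgc) ≥ (μ+4)·count − U L² ≥ m (wL/16π)² − U L² = (κ₀ − U) L²
  set E := (hubbardTorusWith 2 L 1 U μ - ((K' * U / (L : ℝ) ^ 2 : ℝ) : ℂ) •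
      ((pairField dWaveFormFactor L)ᴴ * pairField dWaveFormFactor L)).groundEnergy with hE
  set Z := Real.log ((hubbardTorusWith 2 L 1 U μ - ((K' * U / (L : ℝ) ^ 2 : ℝ) : ℂ) •
      ((pairField dWaveFormFactor L)ᴴ * pairField dWaveFormFactor L)).partitionFn β).re with hZdef
  set A := (hubbardTorus 2 L 1 U - ((K' * U / (L : ℝ) ^ 2 : ℝ) : ℂ) •
      ((pairField dWaveFormFactor L)ᴴ * pairField dWaveFormFactor L)).minEnergyOn
      (szSector (Λ := FermionTorus 2 L) (2 * ⌊(1 - (1 : ℝ)) * (L : ℝ) ^ 2 / 2⌋₊) 0) with hAdef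
  have hcount : κ₀ * (L : ℝ) ^ 2 ≤ (μ + 4) *
      ((Finset.univ.filter fun k : TorusSite 2 L => |torusBand L k - (-4)| ≤ w).card : ℝ) := by
    have h1 : m * (w * L / (16 * Real.pi)) ^ 2 ≤ (μ + 4) * (w * L / (16 * Real.pi)) ^ 2 :=
      mul_le_mul_of_nonneg_right (by linarith [hμm.1]) (sq_nonneg _)
    have h2 : (μ + 4) * (w * L / (16 * Real.pi)) ^ 2 ≤ (μ + 4) *
        ((Finset.univ.filter fun k : TorusSite 2 L => |torusBand L k - (-4)| ≤ w).card : ℝ) :=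
      mul_le_mul_of_nonneg_left hcnt (by linarith [hμm.1])
    have e : κ₀ * (L : ℝ) ^ 2 = m * (w * L / (16 * Real.pi)) ^ 2 := by rw [hκ₀]; ring
    rw [e]; exact h1.trans h2
  have hEneg : κ₀ * (L : ℝ) ^ 2 - U * (L : ℝ) ^ 2 ≤ -E := by linarith [hE1, hE2, hcount]
  have hZ' : κ₀ - U ≤ Z / (β * (L : ℝ) ^ 2) := by
    rw [le_div_iff₀ (mul_pos hβpos hLpos)]
    have h5 := mul_le_mul_of_nonneg_left hEneg hβpos.le
    rw [mul_neg] at h5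
    have e2 : (κ₀ - U) * (β * (L : ℝ) ^ 2) = β * (κ₀ * (L : ℝ) ^ 2 - U * (L : ℝ) ^ 2) := by ring
    rw [e2]
    linarith [h5, hZ]
  have hA' : 0 ≤ A / (L : ℝ) ^ 2 := div_nonneg hA hLpos.le
  have hinst' : A / (L : ℝ) ^ 2 + Z / (β * (L : ℝ) ^ 2) ≤ Real.log 4 / β + κ₀ / 8 := hinst
  linarith


end Landed

/-! ## §0 Notation and read-back -/

/-- The seeded canonical Hamiltonian `Hcan U g = hubbardTorus 2 L 1 U − (g/L²)·Δ_dᴴΔ_d`. -/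
abbrev Hcan (L : ℕ) [NeZero L] (U g : ℝ) :
    Matrix (Finset (Orb (FermionTorus 2 L))) (Finset (Orb (FermionTorus 2 L))) ℂ :=
  hubbardTorus 2 L 1 U - ((g / (L : ℝ) ^ 2 : ℝ) : ℂ) • ((pairField dWaveFormFactor L)ᴴ * pairField dWaveFormFactor L)

/-- The seeded grand-canonical Hamiltonian `Hgc U μ g = hubbardTorusWith 2 L 1 U μ − (g/L²)·Δ_dᴴΔ_d`. -/
abbrev Hgc (L : ℕ) [NeZero L] (U μ g : ℝ) :
    Matrix (Finset (Orb (FermionTorus 2 L))) (Finset (Orb (FermionTorus 2 L))) ℂ :=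
  hubbardTorusWith 2 L 1 U μ - ((g / (L : ℝ) ^ 2 : ℝ) : ℂ) • ((pairField dWaveFormFactor L)ᴴ * pairField dWaveFormFactor L)

/-- The crux's particle number `N_L = 2⌊(1−δ)L²/2⌋₊`. -/
abbrev NL (δ : ℝ) (L : ℕ) : ℕ := 2 * ⌊(1 - δ) * (L : ℝ) ^ 2 / 2⌋₊

/-- The BODY of R at doping `δ`, with a general allowance `A(β)` in place of `log 4/β`. -/
def RBodyWith (A : ℝ → ℝ) (δ : ℝ) : Prop :=
  ∃ μ₁ μ₂ : ℝ, -4 < μ₁ ∧ μ₁ ≤ μ₂ ∧ μ₂ < 0 ∧ ∃ a K' U₀ : ℝ, 0 < a ∧ 0 < K' ∧ 0 < U₀ ∧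
    ∀ U ∈ Set.Ioc (0 : ℝ) U₀, ∀ g ∈ Set.Icc (K' * U) (1 / 10), ∀ β : ℝ, 1 ≤ β → β ≤ Real.exp (a / U) →
      ∃ μ ∈ Set.Icc μ₁ μ₂, ∀ ε : ℝ, 0 < ε → ∃ L₀ : ℕ, ∀ (L : ℕ) [NeZero L], L₀ ≤ L →
        (Hcan L U g).minEnergyOn (szSector (Λ := FermionTorus 2 L) (NL δ L) 0) / (L : ℝ) ^ 2 +
            Real.log ((Hgc L U μ g).partitionFn β).re / (β * (L : ℝ) ^ 2) -
            μ * (2 * (⌊(1 - δ) * (L : ℝ) ^ 2 / 2⌋₊ : ℝ)) / (L : ℝ) ^ 2 ≤ A β + ε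

/-- The BODY of R at doping `δ` (allowance `log 4/β`). -/
def RBodyAt (δ : ℝ) : Prop := RBodyWith (fun β => Real.log 4 / β) δ

/-- R with a general allowance. -/
def RWithAllowance (A : ℝ → ℝ) : Prop := ∀ δ ∈ Set.Icc (1/10 : ℝ) (2/5 : ℝ), RBodyWith A δ

/-- READ-BACK: the crux is, definitionally, `∀ δ ∈ [1/10,2/5], RBodyAt δ`. -/
theorem r_iff_forall_rBodyAt :
    TwSeededEnsembleEquivalenceR ↔ ∀ δ ∈ Set.Icc (1/10 : ℝ) (2/5 : ℝ), RBodyAt δ := Iff.rfl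

/-- READ-BACK: … and `RWithAllowance (log 4/·)`. -/
theorem r_iff_rWithAllowance_log4 :
    TwSeededEnsembleEquivalenceR ↔ RWithAllowance (fun β => Real.log 4 / β) := Iff.rfl

/-! ## §1 Load-bearing analysis -/

/-! ### (H-allow) the entropy allowance — LOAD-BEARING (landed: Negative/Allowance.lean) -/

/-- **Any allowance below the thermal floor is refuted** (repaired shape): if `A(β₀) < (2/β₀)log(1+e^{−8β₀})` at
one `β₀ ≥ 1` then `¬ RWithAllowance A`. (= landed `twSeededEnsembleEquivalenceR_false_of_allowance_lt`.) -/
theorem rWithAllowance_false_of_lt (A : ℝ → ℝ) {β₀ : ℝ} (hβ₀ : 1 ≤ β₀)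
    (hA : A β₀ < 2 / β₀ * Real.log (1 + Real.exp (-(8 * β₀)))) : ¬ RWithAllowance A :=
  twSeededEnsembleEquivalenceR_false_of_allowance_lt A hβ₀ hA

/-- R WITHOUT the allowance (right-hand side `ε` alone). -/
def RWithoutAllowance : Prop := RWithAllowance (fun _ => 0)

/-- **The allowance is load-bearing**: `¬ RWithoutAllowance`. Any proof of R must spend `log 4/β`.
(The landed def-free `twSeededEnsembleEquivalenceR_false_without_allowance` states the same with right-hand side `ε`
in place of `0 + ε`.) -/
theorem r_false_without_allowance : ¬ RWithoutAllowance := by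
  refine rWithAllowance_false_of_lt (fun _ => 0) le_rfl ?_
  show (0:ℝ) < 2 / 1 * Real.log (1 + Real.exp (-(8 * 1)))
  have : 0 < Real.log (1 + Real.exp (-(8 * (1 : ℝ)))) :=
    Real.log_pos (by linarith [Real.exp_pos (-(8 * (1:ℝ)))])
  positivity

/-- Numerical: `log 4 · e^{−9} < 2 log(1 + e^{−8})` (`log 2 < 0.6932`, `e^{−1} < 0.3679`, `log(1+x) ≥ x/(1+x) ≥ x/2`). -/
theorem log4_mul_exp_neg_nine_lt :
    Real.log 4 * Real.exp (-(9 * (1:ℝ))) < 2 / 1 * Real.log (1 + Real.exp (-(8 * (1:ℝ)))) := by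
  set x := Real.exp (-(8 * (1:ℝ))) with hxdef
  have hx : 0 < x := Real.exp_pos _
  have hx1 : x ≤ 1 := by
    rw [hxdef, show (1:ℝ) = Real.exp 0 from Real.exp_zero.symm]
    exact Real.exp_le_exp.2 (by norm_num)
  have hlog : x / 2 ≤ Real.log (1 + x) := by
    have h1 := Real.one_sub_inv_le_log_of_pos (show 0 < 1 + x by positivity)
    have h2 : x / 2 ≤ 1 - (1 + x)⁻¹ := by
      rw [show 1 - (1 + x)⁻¹ = x / (1 + x) by field_simp; ring]
      exact div_le_div_of_nonneg_left hx.le (by positivity) (by linarith)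
    linarith
  have h9 : Real.exp (-(9 * (1:ℝ))) = Real.exp (-1) * x := by
    rw [hxdef, ← Real.exp_add]; norm_num
  have hlog4 : Real.log 4 = 2 * Real.log 2 := by
    rw [show (4 : ℝ) = 2 ^ 2 by norm_num, Real.log_pow]; push_cast; ring
  have hl2 := Real.log_two_lt_d9
  have hl2pos : 0 < Real.log 2 := Real.log_pos (by norm_num)
  have he1 := Real.exp_neg_one_lt_d9
  have he1pos : 0 < Real.exp (-1) := Real.exp_pos _
  have hp := mul_lt_mul'' hl2 he1 hl2pos.le he1pos.le
  have hc : 2 * Real.log 2 * Real.exp (-1) < 1 := by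
    norm_num at hp ⊢
    nlinarith [hp]
  rw [h9, hlog4, div_one]
  have h3 : 2 * Real.log 2 * (Real.exp (-1) * x) < x := by
    have := mul_lt_mul_of_pos_right hc hx
    have e : 2 * Real.log 2 * (Real.exp (-1) * x) = 2 * Real.log 2 * Real.exp (-1) * x := by ring
    rw [e]; linarith
  linarith

/-- **(S1) Exponentially small allowances are refuted already at `β₀ = 1`**: R with `log 4/β` replaced by
`log 4·e^{−9β}` is FALSE. No line may aim at an allowance decaying faster than the free thermal excess. -/
theorem rWithAllowance_exp_false : ¬ RWithAllowance (fun β => Real.log 4 * Real.exp (-(9 * β))) :=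
  rWithAllowance_false_of_lt _ le_rfl log4_mul_exp_neg_nine_lt

/-- **Template H′ (polynomial floor), kill form**: if `A(β₀) < (2/β₀) log(1+e^{−1}) (16πβ₀)⁻²` at one `β₀ ≥ 1` then
`¬ RWithAllowance A`. (= `twSeededEnsembleEquivalenceR_false_of_allowance_lt_cube`, landed: Negative/PolynomialFloor.lean.) -/
theorem rWithAllowance_false_of_lt_cube (A : ℝ → ℝ) {β₀ : ℝ} (hβ₀ : 1 ≤ β₀)
    (hA : A β₀ < 2 / β₀ * Real.log (1 + Real.exp (-1)) * (1 / (16 * Real.pi * β₀)) ^ 2) : ¬ RWithAllowance A :=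
  twSeededEnsembleEquivalenceR_false_of_allowance_lt_cube A hβ₀ hA

/-- **(S1′) No `O(β⁻⁴)` allowance, any constant**: `¬ RWithAllowance (C/β⁴)`. The allowance is load-bearing at EVERY
temperature scale of the window (the free thermal excess is `≍ T²`; the checked floor is `≍ T³`). -/
theorem r_false_of_allowance_inv_pow_four (C : ℝ) : ¬ RWithAllowance (fun β => C / β ^ 4) :=
  twSeededEnsembleEquivalenceR_false_of_allowance_inv_pow_four C

/-! ### (H-δlow) the doping floor `1/10 ≤ δ` — LOAD-BEARING (landed: Negative/HalfFilling.lean) -/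

/-- **The body of R at half filling is false**: `¬ RBodyAt 0`.
(= landed `twSeededEnsembleEquivalenceR_body_false_at_halfFilling`.) -/
theorem rBodyAt_zero_false : ¬ RBodyAt 0 :=
  twSeededEnsembleEquivalenceR_body_false_at_halfFilling

/-- … while R itself is untouched: `0 ∉ [1/10, 2/5]` (audit trail). -/
theorem zero_not_mem_window : (0 : ℝ) ∉ Set.Icc (1/10 : ℝ) (2/5 : ℝ) := by
  intro h; linarith [h.1]

/-! ### (H-δhigh) the doping ceiling `δ ≤ 2/5` — LOAD-BEARING at the empty band (landed: Negative/EmptyBand.lean) -/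

/-- **The body of R at the empty band is false**: `¬ RBodyAt 1` — a COLD kill through a hull gap `(μ₁+4)(w/16π)² − U`
per site that is not exponentially small in `1/U` (the one executed instance of Template C_R's kill shape).
(= `twSeededEnsembleEquivalenceR_body_false_at_emptyBand`.) -/
theorem rBodyAt_one_false : ¬ RBodyAt 1 :=
  twSeededEnsembleEquivalenceR_body_false_at_emptyBand

/-- … while R itself is untouched: `1 ∉ [1/10, 2/5]` (audit trail). -/
theorem one_not_mem_window : (1 : ℝ) ∉ Set.Icc (1/10 : ℝ) (2/5 : ℝ) := by
  intro h; linarith [h.2]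

/-! ### (H-β≥1) the temperature floor `1 ≤ β` — NOT load-bearing; R collapses to its coldest slice -/

/-- R with `β ∈ (0, e^{a/U}]` in place of `[1, e^{a/U}]` (formally stronger). -/
def RPosBeta : Prop :=
  ∀ δ ∈ Set.Icc (1/10 : ℝ) (2/5 : ℝ), ∃ μ₁ μ₂ : ℝ, -4 < μ₁ ∧ μ₁ ≤ μ₂ ∧ μ₂ < 0 ∧ ∃ a K' U₀ : ℝ, 0 < a ∧ 0 < K' ∧ 0 < U₀ ∧
    ∀ U ∈ Set.Ioc (0 : ℝ) U₀, ∀ g ∈ Set.Icc (K' * U) (1 / 10), ∀ β : ℝ, 0 < β → β ≤ Real.exp (a / U) →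
      ∃ μ ∈ Set.Icc μ₁ μ₂, ∀ ε : ℝ, 0 < ε → ∃ L₀ : ℕ, ∀ (L : ℕ) [NeZero L], L₀ ≤ L →
        (Hcan L U g).minEnergyOn (szSector (Λ := FermionTorus 2 L) (NL δ L) 0) / (L : ℝ) ^ 2 +
            Real.log ((Hgc L U μ g).partitionFn β).re / (β * (L : ℝ) ^ 2) -
            μ * (2 * (⌊(1 - δ) * (L : ℝ) ^ 2 / 2⌋₊ : ℝ)) / (L : ℝ) ^ 2 ≤ Real.log 4 / β + ε

/-- R at its COLDEST SLICE `β = e^{a/U}` only (formally weaker). -/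
def RCold : Prop :=
  ∀ δ ∈ Set.Icc (1/10 : ℝ) (2/5 : ℝ), ∃ μ₁ μ₂ : ℝ, -4 < μ₁ ∧ μ₁ ≤ μ₂ ∧ μ₂ < 0 ∧ ∃ a K' U₀ : ℝ, 0 < a ∧ 0 < K' ∧ 0 < U₀ ∧
    ∀ U ∈ Set.Ioc (0 : ℝ) U₀, ∀ g ∈ Set.Icc (K' * U) (1 / 10),
      ∃ μ ∈ Set.Icc μ₁ μ₂, ∀ ε : ℝ, 0 < ε → ∃ L₀ : ℕ, ∀ (L : ℕ) [NeZero L], L₀ ≤ L →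
        (Hcan L U g).minEnergyOn (szSector (Λ := FermionTorus 2 L) (NL δ L) 0) / (L : ℝ) ^ 2 +
            Real.log ((Hgc L U μ g).partitionFn (Real.exp (a / U))).re / (Real.exp (a / U) * (L : ℝ) ^ 2) -
            μ * (2 * (⌊(1 - δ) * (L : ℝ) ^ 2 / 2⌋₊ : ℝ)) / (L : ℝ) ^ 2 ≤ Real.log 4 / Real.exp (a / U) + ε

/-- `RCold → RPosBeta`: the coldest slice carries every warmer one, with the SAME `μ, ε, L₀` (Template D). -/
theorem rPosBeta_of_rCold (h : RCold) : RPosBeta := by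
  intro δ hδ
  obtain ⟨μ₁, μ₂, hμ₁, hμ₁₂, hμ₂, a, K', U₀, ha, hK', hU₀, H⟩ := h δ hδ
  refine ⟨μ₁, μ₂, hμ₁, hμ₁₂, hμ₂, a, K', U₀, ha, hK', hU₀, fun U hU g hg β hβ hβa => ?_⟩
  obtain ⟨μ, hμm, hμ⟩ := H U hU g hg
  refine ⟨μ, hμm, fun ε hε => ?_⟩
  obtain ⟨L₀, hL₀⟩ := hμ ε hε
  refine ⟨L₀, fun L _ hL => ?_⟩
  exact twSeededEnsembleEquivalence_instance_anti_beta L U μ g _ _ hβ hβa (hL₀ L hL)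

/-- `RPosBeta → R` (restriction). -/
theorem r_of_rPosBeta (h : RPosBeta) : TwSeededEnsembleEquivalenceR := by
  intro δ hδ
  obtain ⟨μ₁, μ₂, hμ₁, hμ₁₂, hμ₂, a, K', U₀, ha, hK', hU₀, H⟩ := h δ hδ
  exact ⟨μ₁, μ₂, hμ₁, hμ₁₂, hμ₂, a, K', U₀, ha, hK', hU₀,
    fun U hU g hg β hβ hβa => H U hU g hg β (lt_of_lt_of_le one_pos hβ) hβa⟩

/-- `R → RCold` (specialisation to `β = e^{a/U} ≥ 1`). -/
theorem rCold_of_r (h : TwSeededEnsembleEquivalenceR) : RCold := by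
  intro δ hδ
  obtain ⟨μ₁, μ₂, hμ₁, hμ₁₂, hμ₂, a, K', U₀, ha, hK', hU₀, H⟩ := h δ hδ
  refine ⟨μ₁, μ₂, hμ₁, hμ₁₂, hμ₂, a, K', U₀, ha, hK', hU₀, fun U hU g hg => ?_⟩
  have h1 : 1 ≤ Real.exp (a / U) := by
    rw [show (1:ℝ) = Real.exp 0 from Real.exp_zero.symm]
    exact Real.exp_le_exp.2 (div_nonneg ha.le hU.1.le)
  exact H U hU g hg (Real.exp (a / U)) h1 le_rfl

/-- **`1 ≤ β` is not load-bearing, and R is its coldest slice**: `R ↔ RPosBeta ↔ RCold`. -/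
theorem r_iff_rPosBeta : TwSeededEnsembleEquivalenceR ↔ RPosBeta :=
  ⟨fun h => rPosBeta_of_rCold (rCold_of_r h), r_of_rPosBeta⟩

theorem r_iff_rCold : TwSeededEnsembleEquivalenceR ↔ RCold :=
  ⟨rCold_of_r, fun h => r_of_rPosBeta (rPosBeta_of_rCold h)⟩

/-! ## §2 The kill criterion for R (Template C_R): cold hull defect `≤ log 4·e^{−a/U}` -/

/-- **R ⟹ the T = 0 hull defect is at most `log 4·e^{−a/U}`** (necessary condition; `Z ≥ e^{−βE₀}` at the cold
end). For every admissible `(U, g)` some `μ` in the window has, for every `κ > 0`, eventually in `L`: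
`minE(Hcan, szSector N_L 0) − μN_L − E₀(Hgc μ) ≤ (log 4·e^{−a/U} + κ)·L²`. -/
theorem r_coldHullDefect_le (h : TwSeededEnsembleEquivalenceR) :
    ∀ δ ∈ Set.Icc (1/10 : ℝ) (2/5 : ℝ), ∃ μ₁ μ₂ : ℝ, -4 < μ₁ ∧ μ₁ ≤ μ₂ ∧ μ₂ < 0 ∧ ∃ a K' U₀ : ℝ, 0 < a ∧ 0 < K' ∧ 0 < U₀ ∧
      ∀ U ∈ Set.Ioc (0 : ℝ) U₀, ∀ g ∈ Set.Icc (K' * U) (1 / 10),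
        ∃ μ ∈ Set.Icc μ₁ μ₂, ∀ κ : ℝ, 0 < κ → ∃ L₀ : ℕ, ∀ (L : ℕ) [NeZero L], L₀ ≤ L →
          (Hcan L U g).minEnergyOn (szSector (Λ := FermionTorus 2 L) (NL δ L) 0) - μ * (NL δ L : ℝ) -
              (Hgc L U μ g).groundEnergy ≤ (Real.log 4 * Real.exp (-(a / U)) + κ) * (L : ℝ) ^ 2 := by
  intro δ hδ
  obtain ⟨μ₁, μ₂, hμ₁, hμ₁₂, hμ₂, a, K', U₀, ha, hK', hU₀, H⟩ := rCold_of_r h δ hδ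
  refine ⟨μ₁, μ₂, hμ₁, hμ₁₂, hμ₂, a, K', U₀, ha, hK', hU₀, fun U hU g hg => ?_⟩
  obtain ⟨μ, hμm, hμ⟩ := H U hU g hg
  refine ⟨μ, hμm, fun κ hκ => ?_⟩
  obtain ⟨L₀, hL₀⟩ := hμ κ hκ
  refine ⟨L₀, fun L _ hL => ?_⟩
  have hinst := hL₀ L hL
  set β := Real.exp (a / U) with hβ
  have hβpos : 0 < β := Real.exp_pos _
  have hLpos : (0 : ℝ) < (L : ℝ) ^ 2 := cast_sq_pos_of_neZero L
  have hZ := neg_mul_groundEnergy_le_log_partitionFn (isHermitian_seededGC L U μ g) β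
  set E := (Hgc L U μ g).groundEnergy
  set A := (Hcan L U g).minEnergyOn (szSector (Λ := FermionTorus 2 L) (NL δ L) 0)
  set Z := Real.log ((Hgc L U μ g).partitionFn β).re
  have hZ' : -(E / (L : ℝ) ^ 2) ≤ Z / (β * (L : ℝ) ^ 2) := by
    rw [le_div_iff₀ (mul_pos hβpos hLpos)]
    have : -(E / (L : ℝ) ^ 2) * (β * (L : ℝ) ^ 2) = -(β * E) := by
      calc -(E / (L : ℝ) ^ 2) * (β * (L : ℝ) ^ 2) = -((E / (L : ℝ) ^ 2 * (L : ℝ) ^ 2) * β) := by ring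
        _ = -(E * β) := by rw [div_mul_cancel₀ E hLpos.ne']
        _ = -(β * E) := by ring
    linarith
  have hNL : (2 * (⌊(1 - δ) * (L : ℝ) ^ 2 / 2⌋₊ : ℝ)) = (NL δ L : ℝ) := by push_cast [NL]; ring
  rw [hNL] at hinst
  have hexp : Real.log 4 / β = Real.log 4 * Real.exp (-(a / U)) := by
    rw [hβ, Real.exp_neg, div_eq_mul_inv]
  -- per-site form
  have h1 : A / (L : ℝ) ^ 2 - μ * (NL δ L : ℝ) / (L : ℝ) ^ 2 - E / (L : ℝ) ^ 2 ≤
      Real.log 4 * Real.exp (-(a / U)) + κ := by linarith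
  have h2 : (A - μ * (NL δ L : ℝ) - E) / (L : ℝ) ^ 2 ≤ Real.log 4 * Real.exp (-(a / U)) + κ := by
    have e : (A - μ * (NL δ L : ℝ) - E) / (L : ℝ) ^ 2 =
        A / (L : ℝ) ^ 2 - μ * (NL δ L : ℝ) / (L : ℝ) ^ 2 - E / (L : ℝ) ^ 2 := by
      field_simp
    rw [e]; exact h1
  rwa [div_le_iff₀ hLpos] at h2

/-- **Template C_R — THE KILL FORM FOR R.** R is refuted by: some `δ ∈ [1/10,2/5]` such that for EVERY window
`[μ₁,μ₂] ⊂ (−4,0)` and EVERY `a, K', U₀ > 0` there are admissible `U ∈ (0,U₀]`, `g ∈ [K'U,1/10]` and a margin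
`κ > log 4·e^{−a/U}` with, for every slope `μ` of the window, FREQUENTLY in `L`, the T = 0 hull gap
`minE(Hcan U g, szSector N_L 0) − μN_L − E₀(Hgc U μ g) ≥ κL²`. Since `a` and `U₀` are the prover's, the gap
must fail to be exponentially small in `1/U`: this is the quantitative "kill asymmetry" of the repaired crux. -/
theorem r_false_of_coldHullGap
    (hgap : ∃ δ ∈ Set.Icc (1/10 : ℝ) (2/5 : ℝ), ∀ μ₁ μ₂ : ℝ, -4 < μ₁ → μ₁ ≤ μ₂ → μ₂ < 0 →
      ∀ a K' U₀ : ℝ, 0 < a → 0 < K' → 0 < U₀ → ∃ U ∈ Set.Ioc (0 : ℝ) U₀, ∃ g ∈ Set.Icc (K' * U) (1 / 10),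
        ∃ κ : ℝ, Real.log 4 * Real.exp (-(a / U)) < κ ∧ ∀ μ ∈ Set.Icc μ₁ μ₂, ∀ L₀ : ℕ, ∃ L : ℕ, ∃ _ : NeZero L,
          L₀ ≤ L ∧ κ * (L : ℝ) ^ 2 ≤ (Hcan L U g).minEnergyOn (szSector (Λ := FermionTorus 2 L) (NL δ L) 0) -
            μ * (NL δ L : ℝ) - (Hgc L U μ g).groundEnergy) :
    ¬ TwSeededEnsembleEquivalenceR := by
  intro hR
  obtain ⟨δ, hδ, hgap⟩ := hgap
  obtain ⟨μ₁, μ₂, hμ₁, hμ₁₂, hμ₂, a, K', U₀, ha, hK', hU₀, H⟩ := r_coldHullDefect_le hR δ hδ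
  obtain ⟨U, hU, g, hg, κ, hκ, hgap⟩ := hgap μ₁ μ₂ hμ₁ hμ₁₂ hμ₂ a K' U₀ ha hK' hU₀
  obtain ⟨μ, hμm, hμ⟩ := H U hU g hg
  obtain ⟨L₀, hL₀⟩ := hμ ((κ - Real.log 4 * Real.exp (-(a / U))) / 2) (by linarith)
  obtain ⟨L, _, hL, hgapL⟩ := hgap μ hμm L₀
  have hinst := hL₀ L hL
  have hLpos : (0 : ℝ) < (L : ℝ) ^ 2 := cast_sq_pos_of_neZero L
  have : κ * (L : ℝ) ^ 2 ≤ (Real.log 4 * Real.exp (-(a / U)) + (κ - Real.log 4 * Real.exp (-(a / U))) / 2) *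
      (L : ℝ) ^ 2 := hgapL.trans hinst
  have := le_of_mul_le_mul_right this hLpos
  linarith

/-- **Coupling transfer of the kill margin (Template F, landed `hullGap_coupling_transfer`), read for R**: the hull
gap per site is 1-Lipschitz in `U`, so a kill margin `κ(U,g)` at repulsion `U` is at most the gap of the `U = 0`
seeded model (reduced d-wave BCS) plus `U`. Recorded as the inequality provers/disprovers will quote. -/
theorem hullGap_le_bcs_add_U (L : ℕ) [NeZero L] {U : ℝ} (hU : 0 ≤ U) (μ ν g : ℝ)
    (K : Submodule ℂ (Fock (Orb (FermionTorus 2 L)))) (hK : K ≠ ⊥) :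
    (Hcan L U g).minEnergyOn K - ν - (Hgc L U μ g).groundEnergy ≤
      ((Hcan L 0 g).minEnergyOn K - ν - (Hgc L 0 μ g).groundEnergy) + U * (L : ℝ) ^ 2 := by
  have h := hullGap_coupling_transfer L hU μ ν g K hK
  rw [sub_zero] at h
  exact h

end

end Summit.HubbardSuperconductivity.HubbardSuperconductivity.Cruxes.TwSeededEnsembleEquivalenceR.Disproof
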